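import Summits.ABC.ABC.Theses.DefiniteXi
import Literature.NumberTheory.EllipticCurves.LocalPointsModKernelOfReductionMultiplicativeProofs
import Literature.NumberTheory.EllipticCurves.KodairaNeronUnramifiedInertiaProofs
import Literature.NumberTheory.EllipticCurves.TateCurve.MultiplicativeTwistUnramifiedProofs
import Literature.NumberTheory.EllipticCurves.PastenHeightBoundsLemma68LocalProofs
import Literature.NumberTheory.EllipticCurves.OpenImageMazurTwistProofs
import Literature.NumberTheory.EllipticCurves.OpenImageMazurCharacterProofs
import Literature.NumberTheory.EllipticCurves.OpenImageMazurGoodAtNProofs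
import Literature.NumberTheory.EllipticCurves.OpenImageMazurInertiaProofs
import Literature.NumberTheory.EllipticCurves.OpenImageMazurInertiaThreeProofs
import Literature.NumberTheory.EllipticCurves.CyclicIsogenyCharacterFrobeniusProofs
import Literature.NumberTheory.EllipticCurves.GaloisActionProofs
import Literature.NumberTheory.EllipticCurves.RationalIsogenyDegreesProofs
import Literature.NumberTheory.EllipticCurves.RationalIsogenyFrobeniusCriterionPrimePower
import Literature.NumberTheory.EllipticCurves.OpenImageMazurNumericsProofs
import Literature.NumberTheory.EllipticCurves.HeegnerPointsKolyvaginPrimaryCongruenceProofs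
import Summits.ABC.ABC.Theorems.IsogenyGlueCongruenceMazurKenkuBoundLevelThirtyTwo
import Literature.NumberTheory.EllipticCurves.IsogenyVariableChangeProofs
import Literature.NumberTheory.EllipticCurves.IsogenyCompProofs
import Literature.NumberTheory.EllipticCurves.GlobalMinimalModelProofs
import Literature.NumberTheory.EllipticCurves.SzpiroFreyCurveProofs
import Literature.NumberTheory.EllipticCurves.SzpiroOfAbcProofs
import Literature.NumberTheory.EllipticCurves.NoConductorOne
import Literature.NumberTheory.EllipticCurves.PastenValuationProductThm75MultiplicityProofs
import Literature.NumberTheory.EllipticCurves.SupersingularDensitySerreFrobeniusProofs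
import Literature.NumberTheory.EllipticCurves.RankinSelbergEulerProductGaloisProofs
import Literature.NumberTheory.DiophantineGeometry.GeneralizedFermatTwoPowerCoefficientSerreWeightProofs
import Literature.NumberTheory.DiophantineGeometry.LocalReductionProofs
import Literature.NumberTheory.DiophantineGeometry.Conductor
import Literature.NumberTheory.EllipticCurves.OrdinaryReductionTorsionCharactersProofs
import Literature.NumberTheory.EllipticCurves.OrdinaryReductionUnramifiedCharacterProofs
import Literature.NumberTheory.EllipticCurves.TateCurve.NumberFieldUniformizationTwistedKernelOfReductionIff
import Literature.NumberTheory.EllipticCurves.SelmerCorankControlRatProofs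
import Literature.NumberTheory.EllipticCurves.IsogenyFrobeniusTraceProofs
import Literature.NumberTheory.GaloisRepresentations.DecompositionGroupOfCompletion
import Literature.NumberTheory.GaloisRepresentations.RamificationFiltrationProofs
import Literature.NumberTheory.GaloisRepresentations.TateLevelOneWildOdd
import Literature.NumberTheory.Automorphic.AdicCompletionLocalField
import Literature.NumberTheory.GaloisRepresentations.ModNCyclotomicCharacter
import Summits.ABC.ABC.Theorems.DefiniteXiDefiniteRTControlPrime
import Summits.ABC.ABC.Theorems.DefiniteXiFreyModularity
import Summits.ABC.ABC.Theorems.DefiniteXiDefiniteRTControlPrimeSmulTransportDeg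
import Summits.ABC.ABC.Theorems.DefiniteXiDefiniteRTControlPrimeValTransport
import Summits.ABC.ABC.Theorems.DefiniteXiDefiniteRTControlPrimeFreyScale
import Summits.ABC.ABC.Theorems.DefiniteXiDefiniteRTControlPrimeFreyLocal
import Summits.ABC.ABC.Theorems.IsogenyGlueCongruenceMazurKenkuBoundOfRadius
import Literature.NumberTheory.EllipticCurves.TakahashiDegreeFormulaCoprimeProofs
import Literature.NumberTheory.EllipticCurves.PastenSpectralDegree
import Literature.NumberTheory.EllipticCurves.PastenHeightBounds
import Literature.NumberTheory.EllipticCurves.PastenSpectralDegreeIsogenyBoundProofs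
import Literature.NumberTheory.EllipticCurves.IsogenyDegreeLatticeIndexProofs
import Literature.NumberTheory.EllipticCurves.ModularCurveManinSemistableBridgeProofs
import Literature.NumberTheory.EllipticCurves.ModularDegreeMinimal
import Literature.NumberTheory.EllipticCurves.IsogenyDualProofs
import Literature.NumberTheory.EllipticCurves.IsogenyIdProofs
import Literature.NumberTheory.Automorphic.ShimuraCurveRibetTakahashiComponentOrders
import Literature.NumberTheory.DiophantineGeometry.MinimalDiscriminantFactorizationProofs
import HarnessLib

/-!
# Stub-ideation k=2 (gen 11, FAMILY 2 — RESHAPE) for `stub_pastenLemma68` — crux `DefiniteRTControlPrime`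

Companion to `STUB-IDEAS-stub_pastenLemma68-2.md` (gen 11).  Gen 10 (`StubIdeasK2G10PastenLemma68.lean`)
left exactly two helper BODIES open on the k2 Mazur-free radius line: **D3loc** (the local Tate lemma at a
multiplicative `v ∣ ℓ`) and **T2** (a mechanical port).  Gen 11 RESHAPES D3loc by CHANGING THE OBJECT
(points ↦ units through Tate's twisted `Ψ`, exactly the template of the landed
`WeierstrassCurve.exists_fixedModKernel_nsmul_pow_eq_of_hasMultiplicativeReductionAt`) and SPLITS it
into four unit-level pieces, each XS and elliptic-curve-free except γ:

* α `zpow_exp_eq_zero_of_principal` — a principal unit lying in `q^ℤ` up to an `N`-th power is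
  torsion: `w(u − 1) < 1`, `u^N = Q^n`, `0 < w(Q) < 1` ⇒ `n = 0` (pure valuation algebra);
* β `spectralValuation_sub_one_lt_one_of_pow_prime_pow_eq_one` — at `v ∣ ℓ`, `ζ^{ℓᵏ} = 1 ⇒ |ζ − 1|_v < 1`
  (three lines from the landed `WeierstrassCurve.spectralValuation_sub_one_lt_one_of_pow`);
* γ `toAlgEquiv_eq_of_mem_absInertia_of_sq_eq_gamma` — the twist sign is `+1` on `absInertia K_v`
  (landed `TateCurve.toAlgEquiv_eq_of_mem_inertia_of_sq_eq_gamma` read through `inertia_eq_absInertia`);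
* δ `units_map_div_pow_eq_one` — the Kummer cocycle `σw/w` of an `N`-division value of `q^n` is an
  `N`-th root of unity (pure algebra: `σ` fixes `K_v`).

and then ASSEMBLES D3loc (`exists_multiplicativeContainer_local`, the g10 signature VERBATIM) from
α β γ δ + `modNCyclotomicCharacter_spec` + the landed twisted uniformisation
`TateCurve.exists_twistedTateUniformisation_localKernelOfReduction_iff`.

**FINAL STATUS (gen 11, farm `lean check` rc 0, 0 sorries, 0 warnings): THE WHOLE k2 LINE IS PROVED.**
§4 T2 (`unitsMap_cyclicCharacter_sq_eq_one_of_one_lt_valuation_j`), §5 LOCℓ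
(`cyclicCharacter_eq_one_or_eq_cyclotomic_at_ell`), §6 GLOB⁻ (`unitsMap_cyclicCharacter_pow_twelve_dichotomy`),
§7 H5⁻ (`pow_halfCeil_dvd_frobNorm_of_stableLine`) + G0 (`exists_stableLine_of_isCyclic`), §8 the typed output
C0² `cyclicDegreeDvdFrobNormSq : CyclicDegreeDvdFrobNormSq`, §9 the counting end SUB
`freyIsogenyRadiusSubpoly : FreyIsogenyRadiusSubpoly` (k2-g5's `L1ε`, def verbatim) — all unconditional.
With k2-g5's PROVED consumer `definiteRTControlPrime_of_freyIsogenyRadiusSubpoly` this gives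
`takahashi2001_thm_2_3_of_coprime → DefiniteRTControlPrime`, i.e. the crux from `stub_takahashi` ALONE
(`stub_pastenLemma68` AND `stub_pasten163` deleted); the single-file kernel certificate is
`StubIdeasK2G11CruxFromTakahashi.lean` (this file + g5 inlined + `definiteRTControlPrime_of_takahashi`).
-/

set_option linter.dupNamespace false

namespace Summit.ABC.ABC.Cruxes.DefiniteRTControlPrime.StubIdeas2G11

open Literature.NumberTheory.EllipticCurves Literature.NumberTheory.EllipticCurves.ModularForms
open Literature.NumberTheory.GaloisRepresentations Literature.NumberTheory.EllipticCurves.TateCurve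
open WeierstrassCurve IsDedekindDomain IsDedekindDomain.HeightOneSpectrum NumberField Field
open scoped NumberField NNReal Classical

/-! ## §0 The verbatim stub, by name (verdict unchanged: `blocked-on: stmt-ABC-15193`) -/

example : mazurKenku_exists_cyclic_isogeny → PastenShimura2024_lemma_6_8 :=
  PastenShimura2024_lemma_6_8_of_mazurKenku'

example (h68 : PastenShimura2024_lemma_6_8) {W W' : WeierstrassCurve ℚ} [W.IsElliptic] [W'.IsElliptic]
    (φ : Isogeny W W') {ℓ : ℕ} (hℓ : ℓ.Prime) (hdeg : φ.degree = ℓ) (v : HeightOneSpectrum ℤ)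
    (hv : W.HasMultiplicativeReductionAt v) : ℓ ≤ 163 :=
  prime_degree_le_163_of_PastenShimura2024_lemma_6_8 h68 φ hℓ hdeg v hv

/-! ## §1 The four unit-level pieces of D3loc -/

section Pieces

variable {K : Type} [Field K] [NumberField K] {v : HeightOneSpectrum (𝓞 K)}

/-- **α (XS, pure valuation algebra).**  A principal unit which is an `N`-division value of `q^ℤ` is an
`N`-th root of unity: the exponent of `q` vanishes. [folklore] -/
theorem zpow_exp_eq_zero_of_principal {L : Type*} [Field L] (w : Valuation L ℝ≥0) {u Q : L}
    (hu : w (u - 1) < 1) (hQ0 : Q ≠ 0) (hQ : w Q < 1) {N : ℕ} {n : ℤ} (h : u ^ N = Q ^ n) :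
    n = 0 := by
  have hu1 : w u = 1 := by
    have h1 := Valuation.map_add_eq_of_lt_left w (x := (1 : L)) (y := u - 1)
      (by rw [map_one]; exact hu)
    rwa [map_one, add_sub_cancel] at h1
  have hQn : w Q ^ n = w Q ^ (0 : ℤ) := by
    rw [zpow_zero, ← map_zpow₀, ← h, map_pow, hu1, one_pow]
  exact (zpow_right_strictAnti₀ ((Valuation.pos_iff _).mpr hQ0) hQ).injective hQn

/-- **β (XS).**  At a place `v ∣ ℓ`, every `ℓ`-power root of unity of `K̄_v` is a principal unit
(Frobenius is injective on `k̄_v`). [cite: SerreLocalFields1979, Ch. IV §4 Prop. 17] -/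
theorem spectralValuation_sub_one_lt_one_of_pow_prime_pow_eq_one {ℓ : ℕ} [Fact ℓ.Prime]
    (hℓv : ((ℓ : ℕ) : 𝓞 K) ∈ v.asIdeal) (k : ℕ) {ζ : AlgebraicClosure (v.adicCompletion K)}
    (hζ : ζ ^ ℓ ^ k = 1) : v.spectralValuation (ζ - 1) < 1 := by
  have h1 : v.spectralValuation ζ = 1 := by
    have h : v.spectralValuation ζ ^ ℓ ^ k = 1 := by rw [← map_pow, hζ, map_one]
    exact (pow_eq_one_iff_of_nonneg zero_le (pow_ne_zero _ (Fact.out : ℓ.Prime).ne_zero)).mp h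
  exact WeierstrassCurve.spectralValuation_sub_one_lt_one_of_pow hℓv k h1
    (by rw [hζ, sub_self, map_zero]; exact one_pos)

/-- **γ (XS).**  The twist sign of Tate's uniformisation is `+1` on the absolute inertia group of `K_v`:
`σ t = t` for `t² = γ(W) = −c₄/c₆` and `σ ∈ absInertia K_v`. [cite: SilvermanATAEC1994, Thm. V.5.3 (b)] -/
theorem toAlgEquiv_eq_of_mem_absInertia_of_sq_eq_gamma (W : WeierstrassCurve K) [W.IsElliptic]
    (hmult : W.HasMultiplicativeReductionAt v) {t : AlgebraicClosure (v.adicCompletion K)}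
    (ht : t ^ 2 = algebraMap (v.adicCompletion K) (AlgebraicClosure (v.adicCompletion K))
      (algebraMap K (v.adicCompletion K) (-(W.c₄ / W.c₆))))
    {σ : absoluteGaloisGroup (v.adicCompletion K)} (hσ : σ ∈ absInertia (v.adicCompletion K)) :
    absoluteGaloisGroup.toAlgEquiv (v.adicCompletion K) σ t = t := by
  obtain ⟨𝔐, h𝔐⟩ := v.localPrimesAbove_nonempty
  rw [← inertia_eq_absInertia (coe_spectralValuation v) h𝔐] at hσ
  exact toAlgEquiv_eq_of_mem_inertia_of_sq_eq_gamma W hmult h𝔐 ht hσ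

/-- **δ (XS, pure algebra).**  The Kummer cocycle of an `N`-division value of `q^n` (`q ∈ K_v`) is an
`N`-th root of unity: `(σw/w)^N = σ(q^n)/q^n = 1`. [folklore] -/
theorem units_map_div_pow_eq_one {q : v.adicCompletion K} (hq0 : q ≠ 0)
    (σ : absoluteGaloisGroup (v.adicCompletion K)) {w : (AlgebraicClosure (v.adicCompletion K))ˣ}
    {N : ℕ} {n : ℤ}
    (hw : ((w : AlgebraicClosure (v.adicCompletion K))) ^ N =
      algebraMap (v.adicCompletion K) (AlgebraicClosure (v.adicCompletion K)) q ^ n) :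
    ((Units.map (absoluteGaloisGroup.toAlgEquiv (v.adicCompletion K) σ :
        AlgebraicClosure (v.adicCompletion K) →* AlgebraicClosure (v.adicCompletion K)) w / w :
        (AlgebraicClosure (v.adicCompletion K))ˣ) : AlgebraicClosure (v.adicCompletion K)) ^ N = 1 := by
  have hq' : algebraMap (v.adicCompletion K) (AlgebraicClosure (v.adicCompletion K)) q ≠ 0 :=
    (map_ne_zero_iff _ (algebraMap (v.adicCompletion K) _).injective).2 hq0
  rw [Units.val_div_eq_div_val, Units.coe_map, MonoidHom.coe_coe, div_pow, ← map_pow, hw,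
    map_zpow₀, AlgEquiv.commutes, div_self (zpow_ne_zero n hq')]

end Pieces

/-! ## §2 D3loc assembled (g10 signature verbatim) -/

/-- **D3loc (S; g10 signature verbatim; body = α β γ δ + bookkeeping through `Ψ`).**  At a multiplicative
`v ∣ ℓ`: (i) inertia acts on the `ℓᵏ`-torsion of the kernel of reduction `E₁(ℚ̄_v) = Ψ(1 + 𝔪)` through
the local mod-`ℓᵏ` cyclotomic character; (ii) `σQ − Q ∈ E₁(ℚ̄_v)` for every `ℓᵏ`-torsion `Q` and inertial `σ`.
[cite: SilvermanATAEC1994, §V.4–V.5] -/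
theorem exists_multiplicativeContainer_local (W : WeierstrassCurve ℚ) [W.IsElliptic]
    {v : HeightOneSpectrum (𝓞 ℚ)} (hv : W.HasMultiplicativeReductionAt v) {ℓ : ℕ} [Fact ℓ.Prime]
    (hℓv : (ℓ : 𝓞 ℚ) ∈ v.asIdeal) (k : ℕ) [NeZero ((ℓ ^ k : ℕ) : v.adicCompletion ℚ)] :
    (∀ σ ∈ absInertia (v.adicCompletion ℚ), ∀ Q ∈ W.localKernelOfReduction v, ℓ ^ k • Q = 0 →
        σ • Q = ((modNCyclotomicCharacter (v.adicCompletion ℚ) (ℓ ^ k) σ : (ZMod (ℓ ^ k))ˣ) :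
          ZMod (ℓ ^ k)).val • Q) ∧
      (∀ σ ∈ absInertia (v.adicCompletion ℚ), ∀ Q : localPoints W (v.adicCompletion ℚ),
        ℓ ^ k • Q = 0 → σ • Q - Q ∈ W.localKernelOfReduction v) := by
  set L := AlgebraicClosure (v.adicCompletion ℚ) with hL
  obtain ⟨q, t, Ψ, hq0, hq1, -, ht, hsurj, hker, hΨσ, hiff⟩ :=
    exists_twistedTateUniformisation_localKernelOfReduction_iff W v hv
  have hw := coe_spectralValuation v
  set qL := algebraMap (v.adicCompletion ℚ) L q with hqL
  have hq' : qL ≠ 0 := (map_ne_zero_iff _ (algebraMap (v.adicCompletion ℚ) L).injective).2 hq0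
  have hwq : v.spectralValuation qL < 1 := by
    rw [← NNReal.coe_lt_coe, hqL, coe_spectralValuation_algebraMap hw, NNReal.coe_one]
    exact Valued.toNormedField.norm_lt_one_iff.mpr hq1
  -- γ: the sign is `+1` on inertia
  have hsign : ∀ σ ∈ absInertia (v.adicCompletion ℚ), ∀ u : Lˣ,
      σ • Ψ (Additive.ofMul u) =
        Ψ (Additive.ofMul (Units.map (absoluteGaloisGroup.toAlgEquiv (v.adicCompletion ℚ) σ :
          L →* L) u)) := by
    intro σ hσ u
    rw [hΨσ σ u, if_pos (toAlgEquiv_eq_of_mem_absInertia_of_sq_eq_gamma W hv ht hσ), one_zsmul]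
  -- the exponent of `q` in `u^{ℓᵏ}` for `Ψ(u)` killed by `ℓᵏ`
  have hroot : ∀ u : Lˣ, ℓ ^ k • Ψ (Additive.ofMul u) = 0 →
      ∃ n : ℤ, ((u : L)) ^ ℓ ^ k = qL ^ n := by
    intro u hu
    have h0 : Ψ (Additive.ofMul (u ^ ℓ ^ k)) = 0 := by rw [ofMul_pow, map_nsmul, hu]
    obtain ⟨n, hn⟩ := (hker _).mp h0
    exact ⟨n, by rw [← Units.val_pow_eq_pow_val, hn]⟩
  constructor
  · -- (i) `E₁[ℓᵏ] ⊆ Ψ(μ_{ℓᵏ})`, inertia acts by `χ`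
    intro σ hσ Q hQ hQk
    obtain ⟨u, hu1, rfl⟩ := (hiff Q).mp hQ
    obtain ⟨n, hn⟩ := hroot u hQk
    have hn0 : n = 0 := zpow_exp_eq_zero_of_principal v.spectralValuation hu1 hq' hwq hn
    have huN : (u : L) ^ ℓ ^ k = 1 := by rw [hn, hn0, zpow_zero]
    have hσu : absoluteGaloisGroup.toAlgEquiv (v.adicCompletion ℚ) σ (u : L) =
        (u : L) ^ ((modNCyclotomicCharacter (v.adicCompletion ℚ) (ℓ ^ k) σ : (ZMod (ℓ ^ k))ˣ) :
          ZMod (ℓ ^ k)).val :=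
      modNCyclotomicCharacter_spec (v.adicCompletion ℚ) (ℓ ^ k) σ (u : L) huN
    have hmap : Units.map (absoluteGaloisGroup.toAlgEquiv (v.adicCompletion ℚ) σ : L →* L) u =
        u ^ ((modNCyclotomicCharacter (v.adicCompletion ℚ) (ℓ ^ k) σ : (ZMod (ℓ ^ k))ˣ) :
          ZMod (ℓ ^ k)).val :=
      Units.ext (by rw [Units.coe_map, Units.val_pow_eq_pow_val]; exact hσu)
    rw [hsign σ hσ u, hmap, ofMul_pow, map_nsmul]
  · -- (ii) the Kummer cocycle lands in `Ψ(μ_{ℓ^∞}) ⊆ E₁`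
    intro σ hσ Q hQk
    obtain ⟨a, rfl⟩ := hsurj Q
    obtain ⟨w, rfl⟩ : ∃ w : Lˣ, Additive.ofMul w = a := ⟨Additive.toMul a, ofMul_toMul a⟩
    obtain ⟨n, hn⟩ := hroot w hQk
    rw [hsign σ hσ w, ← map_sub, ← ofMul_div]
    refine (hiff _).mpr ⟨_, ?_, rfl⟩
    exact spectralValuation_sub_one_lt_one_of_pow_prime_pow_eq_one hℓv k
      (units_map_div_pow_eq_one hq0 σ hn)


/-! ## §4 T2 at level `ℓᵏ` — the PORT of `Mazur1978.isogenyCharacter_sq_eq_one_of_one_lt_valuation_j`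
(U1/U1k/Z1 copied verbatim from gen 10, where they are proved; T2 body = the port itself) -/

/-- `⌈k/2⌉` (g3 verbatim). -/
def halfCeil (k : ℕ) : ℕ := (k + 1) / 2

theorem halfCeil_le (k : ℕ) : halfCeil k ≤ k := by unfold halfCeil; omega

theorem pow_halfCeil_dvd (ℓ k : ℕ) : ℓ ^ halfCeil k ∣ ℓ ^ k := pow_dvd_pow ℓ (halfCeil_le k)

/-- U1 (g3/g10 verbatim). -/
theorem pow_halfCeil_dvd_of_sq_smul_eq_zero {M : Type*} [AddCommGroup M] {ℓ k : ℕ} (hℓ : ℓ.Prime)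
    {P : M} (hP : addOrderOf P = ℓ ^ k) {s : ℤ} (hs : ((s - 1) ^ 2) • P = 0) :
    (ℓ : ℤ) ^ halfCeil k ∣ s - 1 := by
  haveI := Fact.mk hℓ
  have h1 : ((ℓ : ℤ) ^ k) ∣ (s - 1) ^ 2 := by
    have := addOrderOf_dvd_iff_zsmul_eq_zero.mpr hs
    rw [hP] at this
    exact_mod_cast this
  rcases eq_or_ne (s - 1) 0 with h0 | h0
  · rw [h0]; exact dvd_zero _
  rw [padicValInt_dvd_iff] at h1 ⊢
  refine Or.inr ?_
  rcases h1 with h1 | h1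
  · exact absurd (pow_eq_zero_iff two_ne_zero |>.mp h1) h0
  · rw [pow_two, padicValInt.mul h0 h0] at h1
    unfold halfCeil
    omega

/-- U1k (g10 verbatim, proved). -/
theorem pow_halfCeil_dvd_sub_one_of_unipotent {A : Type*} [AddCommGroup A] {ℓ k : ℕ} (hℓ : ℓ.Prime)
    {Q : A} (hQ : addOrderOf Q = ℓ ^ k) (τ : A →+ A) {s : ℤ} (hs : τ Q = s • Q)
    (hunip : τ (τ Q - Q) = τ Q - Q) : (ℓ : ℤ) ^ halfCeil k ∣ s - 1 := by
  have h1 : ((s - 1) ^ 2) • Q = 0 := by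
    rw [map_sub, hs, map_zsmul, hs, smul_smul] at hunip
    have h2 : (s * s - s - (s - 1)) • Q = 0 := by
      rw [sub_smul, sub_smul, sub_smul, one_smul, hunip, sub_self]
    rw [show (s - 1) ^ 2 = s * s - s - (s - 1) by ring]
    exact h2
  exact pow_halfCeil_dvd_of_sq_smul_eq_zero hℓ hQ h1

/-- Z1 (g10 verbatim, proved). -/
theorem unitsMap_sq_eq_one_of_dvd_sub_one {ℓ k : ℕ} [NeZero (ℓ ^ k)] (r : (ZMod (ℓ ^ k))ˣ) {s : ℤ}
    (hsr : ((s : ℤ) : ZMod (ℓ ^ k)) = (r : ZMod (ℓ ^ k)) ∨ ((s : ℤ) : ZMod (ℓ ^ k)) = -(r : ZMod (ℓ ^ k)))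
    (hdiv : (ℓ : ℤ) ^ halfCeil k ∣ s - 1) :
    ZMod.unitsMap (pow_halfCeil_dvd ℓ k) r ^ 2 = 1 := by
  have hs1 : ((s : ℤ) : ZMod (ℓ ^ halfCeil k)) = 1 := by
    have h : (((s - 1 : ℤ)) : ZMod (ℓ ^ halfCeil k)) = 0 := by
      rw [ZMod.intCast_zmod_eq_zero_iff_dvd]; exact_mod_cast hdiv
    rwa [Int.cast_sub, Int.cast_one, sub_eq_zero] at h
  have hcast : ((ZMod.unitsMap (pow_halfCeil_dvd ℓ k) r : (ZMod (ℓ ^ halfCeil k))ˣ) :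
      ZMod (ℓ ^ halfCeil k)) = ZMod.castHom (pow_halfCeil_dvd ℓ k) (ZMod (ℓ ^ halfCeil k))
        (r : ZMod (ℓ ^ k)) := rfl
  apply Units.ext
  rw [Units.val_pow_eq_pow_val, Units.val_one, hcast]
  rcases hsr with h | h
  · rw [← h, map_intCast, hs1, one_pow]
  · rw [show (r : ZMod (ℓ ^ k)) = -((s : ℤ) : ZMod (ℓ ^ k)) by rw [h, neg_neg], map_neg, map_intCast,
      hs1, neg_one_sq]

/-- **T2 (the port, g10 signature verbatim).**  `v(j) < 0` at a place `v ∤ ℓ` ⇒ `r̄(τ)² = 1` on inertia at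
`v` at HALF level `ℓ^⌈k/2⌉`.  Line-by-line port of `Mazur1978.isogenyCharacter_sq_eq_one_of_one_lt_valuation_j`
(`N ↦ ℓᵏ`, `(n := 1) ↦ (n := k)`, `intCast_eq_one_of_unipotent ↦ U1k`, last step `↦ Z1`).
[cite: Mazur1978, §5 Prop. 5.1] [cite: SilvermanATAEC1994, V.5 Thm. 5.3] -/
theorem unitsMap_cyclicCharacter_sq_eq_one_of_one_lt_valuation_j (W : WeierstrassCurve ℚ)
    [W.IsElliptic] {v : HeightOneSpectrum (𝓞 ℚ)} (hj : 1 < v.valuation ℚ W.j)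
    {ℓ k : ℕ} [Fact ℓ.Prime] (hℓv : (ℓ : 𝓞 ℚ) ∉ v.asIdeal) (hk : 1 ≤ k)
    {P : geomPoints W} (hP : addOrderOf P = ℓ ^ k)
    {r : absoluteGaloisGroup ℚ →* (ZMod (ℓ ^ k))ˣ}
    (hr : ∀ σ : absoluteGaloisGroup ℚ, σ • P = ((r σ : (ZMod (ℓ ^ k))ˣ) : ZMod (ℓ ^ k)).val • P)
    {𝔓 : Ideal (absIntegers (𝓞 ℚ) ℚ)} (h𝔓 : 𝔓 ∈ v.primesAbove)
    {τ : absoluteGaloisGroup ℚ} (hτ : τ ∈ 𝔓.inertia (absoluteGaloisGroup ℚ)) :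
    ZMod.unitsMap (pow_halfCeil_dvd ℓ k) (r τ) ^ 2 = 1 := by
  have hℓ : ℓ.Prime := Fact.out
  haveI : NeZero (2 : ℚ) := ⟨two_ne_zero⟩
  haveI : NeZero (ℓ ^ k) := ⟨pow_ne_zero _ hℓ.ne_zero⟩
  -- a twist with multiplicative reduction at `v`
  obtain ⟨d, hd0, hmult⟩ :=
    W.exists_hasMultiplicativeReductionAt_quadraticTwist_of_one_lt_valuation_j v hj
  haveI := W.isElliptic_quadraticTwist hd0
  obtain ⟨f, hf⟩ := W.exists_addEquiv_geomPoints_quadraticTwist_signed hd0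
  -- transport `P` to the twist (order is preserved)
  have hNP : ℓ ^ k • P = 0 := by rw [← hP]; exact addOrderOf_nsmul_eq_zero P
  set Q : (W.quadraticTwist d).geomPoints := f.symm P with hQ
  have hfQ : f Q = P := f.apply_symm_apply _
  have hQN : ℓ ^ k • Q = 0 := by
    apply f.injective
    rw [map_nsmul, hfQ, map_zero, hNP]
  have hQord : addOrderOf Q = ℓ ^ k := by
    rw [← addOrderOf_injective f.toAddMonoidHom f.injective Q, AddEquiv.coe_toAddMonoidHom, hfQ, hP]
  -- unipotence of `τ` on `Q` at level `ℓᵏ` (the engine already takes `p ^ n`)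
  have hunip : τ • (τ • Q - Q) = τ • Q - Q :=
    (W.quadraticTwist d).smul_smul_sub_eq_of_mem_inertia_geomPoints hmult hℓ hℓv hk h𝔓 hτ hQN
  -- `τ P = r(τ) P`, `τ Q = ± r(τ) Q`
  have hτP : τ • P = (((r τ : (ZMod (ℓ ^ k))ˣ) : ZMod (ℓ ^ k)).val : ℤ) • P := by
    rw [hr τ, natCast_zsmul]
  set τA : (W.quadraticTwist d).geomPoints →+ (W.quadraticTwist d).geomPoints :=
    DistribSMul.toAddMonoidHom _ τ with hτA
  have hτA' : ∀ R, τA R = τ • R := fun R ↦ rfl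
  obtain ⟨s, hs, hsr⟩ : ∃ s : ℤ, τ • Q = s • Q ∧
      (((s : ℤ) : ZMod (ℓ ^ k)) = ((r τ : (ZMod (ℓ ^ k))ˣ) : ZMod (ℓ ^ k)) ∨
        ((s : ℤ) : ZMod (ℓ ^ k)) = -((r τ : (ZMod (ℓ ^ k))ˣ) : ZMod (ℓ ^ k))) := by
    rcases hf τ with hplus | hminus
    · refine ⟨(((r τ : (ZMod (ℓ ^ k))ˣ) : ZMod (ℓ ^ k)).val : ℤ), ?_, Or.inl (by simp)⟩
      apply f.injective
      rw [hplus, hfQ, hτP, map_zsmul, hfQ]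
    · refine ⟨-(((r τ : (ZMod (ℓ ^ k))ˣ) : ZMod (ℓ ^ k)).val : ℤ), ?_, Or.inr (by simp)⟩
      apply f.injective
      have h2 : f (τ • Q) = -(τ • P) := by rw [hminus, hfQ]
      rw [h2, hτP, map_zsmul, hfQ, neg_zsmul]
  -- U1k in place of `intCast_eq_one_of_unipotent`, then Z1
  have hdiv : (ℓ : ℤ) ^ halfCeil k ∣ s - 1 :=
    pow_halfCeil_dvd_sub_one_of_unipotent hℓ hQord τA (by rw [hτA']; exact hs)
      (by rw [hτA', hτA']; exact hunip)
  exact unitsMap_sq_eq_one_of_dvd_sub_one (r τ) hsr hdiv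


/-! ## §5 LOCℓ ASSEMBLED (gen 11).  Inputs: D1 (g7, proved — copied), CONJ / D-TRANS / D2₀ (g10, proved —
copied), D3loc (§2, proved HERE), SS′ (= the `exfalso` branch of
`Mazur1978.modEq_zero_or_one_of_hasGoodReductionAtPrime`, extracted HERE), H2 (container ⇒ dichotomy). -/

section LOCell

open Rat.HeightOneSpectrum

/-- CONJ (g10 verbatim, proved). -/
theorem eqOn_inertia_of_eqOn_inertia_one {K : Type*} [Field K] [NumberField K] {M : Type*}
    [CommGroup M] (ψ₁ ψ₂ : absoluteGaloisGroup K →* M) (v : HeightOneSpectrum (𝓞 K))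
    {𝔓₀ : Ideal (absIntegers (𝓞 K) K)} (h𝔓₀ : 𝔓₀ ∈ v.primesAbove)
    (h : ∀ τ ∈ 𝔓₀.inertia (absoluteGaloisGroup K), ψ₁ τ = ψ₂ τ)
    {𝔓 : Ideal (absIntegers (𝓞 K) K)} (h𝔓 : 𝔓 ∈ v.primesAbove)
    {τ : absoluteGaloisGroup K} (hτ : τ ∈ 𝔓.inertia (absoluteGaloisGroup K)) :
    ψ₁ τ = ψ₂ τ := by
  obtain ⟨g, rfl⟩ := HeightOneSpectrum.exists_smul_eq_of_mem_primesAbove_holds h𝔓₀ h𝔓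
  rw [absIntegers.inertia_smul, Subgroup.mem_pointwise_smul_iff_inv_smul_mem] at hτ
  have key := h _ hτ
  simp only [MulAut.smul_def] at key
  simpa [map_mul, map_inv, mul_inv_cancel_comm, inv_mul_cancel_comm] using key

/-- D-TRANS (g10 verbatim, proved). -/
theorem container_of_local (W : WeierstrassCurve ℚ) [W.IsElliptic] (v : HeightOneSpectrum (𝓞 ℚ))
    (m : ℕ) [NeZero m] [NeZero (m : v.adicCompletion ℚ)]
    (E₁loc : AddSubgroup (localPoints W (v.adicCompletion ℚ)))
    (h1 : ∀ σ ∈ absInertia (v.adicCompletion ℚ), ∀ Q ∈ E₁loc, m • Q = 0 →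
      σ • Q = ((modNCyclotomicCharacter (v.adicCompletion ℚ) m σ : (ZMod m)ˣ) : ZMod m).val • Q)
    (h2 : ∀ σ ∈ absInertia (v.adicCompletion ℚ), ∀ Q : localPoints W (v.adicCompletion ℚ),
      m • Q = 0 → σ • Q - Q ∈ E₁loc) :
    (∀ τ ∈ (adicCompletionPrime ℚ v).inertia (absoluteGaloisGroup ℚ),
        ∀ Q ∈ E₁loc.comap (pointsMapOfEmb W (closureEmb (v.adicCompletion ℚ))), m • Q = 0 →
        τ • Q = ((((modNCyclotomicCharacter ℚ m τ : (ZMod m)ˣ) : ZMod m).val : ℤ)) • Q) ∧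
    (∀ τ ∈ (adicCompletionPrime ℚ v).inertia (absoluteGaloisGroup ℚ), ∀ Q : geomPoints W,
        m • Q = 0 → τ • Q - Q ∈ E₁loc.comap (pointsMapOfEmb W (closureEmb (v.adicCompletion ℚ)))) := by
  have hinj := pointsMapOfEmb_injective W (closureEmb (K := ℚ) (v.adicCompletion ℚ))
  have hequiv : ∀ (σ : absoluteGaloisGroup (v.adicCompletion ℚ)) (P : geomPoints W),
      pointsMapOfEmb W (closureEmb (K := ℚ) (v.adicCompletion ℚ))
          (absGaloisRestrict ℚ (v.adicCompletion ℚ) σ • P) =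
        σ • pointsMapOfEmb W (closureEmb (K := ℚ) (v.adicCompletion ℚ)) P := by
    intro σ P
    rw [← resGal_eq_absGaloisRestrict, resGal_eq, pointsMapOfEmb_smul]
  constructor
  · intro τ hτ Q hQ hQm
    rw [inertia_adicCompletionPrime_eq_map_absInertia ℚ v] at hτ
    obtain ⟨σ, hσ, rfl⟩ := Subgroup.mem_map.mp hτ
    change absGaloisRestrict ℚ (v.adicCompletion ℚ) σ • Q =
      ((((modNCyclotomicCharacter ℚ m (absGaloisRestrict ℚ (v.adicCompletion ℚ) σ) :
        (ZMod m)ˣ) : ZMod m).val : ℤ)) • Q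
    rw [modNCyclotomicCharacter_absGaloisRestrict, natCast_zsmul]
    apply hinj
    rw [hequiv, map_nsmul]
    refine h1 σ hσ _ (AddSubgroup.mem_comap.mp hQ) ?_
    rw [← map_nsmul, hQm, map_zero]
  · intro τ hτ Q hQm
    rw [inertia_adicCompletionPrime_eq_map_absInertia ℚ v] at hτ
    obtain ⟨σ, hσ, rfl⟩ := Subgroup.mem_map.mp hτ
    change absGaloisRestrict ℚ (v.adicCompletion ℚ) σ • Q - Q ∈ _
    rw [AddSubgroup.mem_comap, map_sub, hequiv]
    refine h2 σ hσ _ ?_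
    rw [← map_nsmul, hQm, map_zero]

/-- D2₀ (g10 verbatim, proved). -/
theorem exists_ordinaryFiltration_adicCompletionPrime (W : WeierstrassCurve ℚ) [W.IsElliptic]
    {v : HeightOneSpectrum (𝓞 ℚ)} (hgood : W.HasGoodReductionAt v) {ℓ : ℕ} [Fact ℓ.Prime]
    (hℓv : (ℓ : 𝓞 ℚ) ∈ v.asIdeal) (hord : ¬ ((ℓ : ℤ) ∣ W.frobeniusTraceAt v)) (k : ℕ) :
    ∃ E₁ : AddSubgroup (geomPoints W),
      (∀ τ ∈ (adicCompletionPrime ℚ v).inertia (absoluteGaloisGroup ℚ), ∀ Q ∈ E₁, ℓ ^ k • Q = 0 →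
        τ • Q = ((((modNCyclotomicCharacter ℚ (ℓ ^ k) τ : (ZMod (ℓ ^ k))ˣ) :
          ZMod (ℓ ^ k)).val : ℤ)) • Q) ∧
      (∀ τ ∈ (adicCompletionPrime ℚ v).inertia (absoluteGaloisGroup ℚ), ∀ Q : geomPoints W,
        ℓ ^ k • Q = 0 → τ • Q - Q ∈ E₁) := by
  haveI : NeZero ((ℓ : ℕ) : v.adicCompletion ℚ) :=
    NeZero.nat_of_injective (algebraMap ℚ (v.adicCompletion ℚ)).injective
  haveI : NeZero ((ℓ ^ k : ℕ) : v.adicCompletion ℚ) :=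
    NeZero.nat_of_injective (algebraMap ℚ (v.adicCompletion ℚ)).injective
  refine ⟨(W.localKernelOfReduction v).comap (pointsMapOfEmb W (closureEmb (v.adicCompletion ℚ))),
    ?_, ?_⟩
  · intro τ hτ Q hQ hQk
    rw [inertia_adicCompletionPrime_eq_map_absInertia ℚ v] at hτ
    obtain ⟨σ, hσ, rfl⟩ := Subgroup.mem_map.mp hτ
    change absGaloisRestrict ℚ (v.adicCompletion ℚ) σ • Q =
      ((((modNCyclotomicCharacter ℚ (ℓ ^ k) (absGaloisRestrict ℚ (v.adicCompletion ℚ) σ) :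
        (ZMod (ℓ ^ k))ˣ) : ZMod (ℓ ^ k)).val : ℤ)) • Q
    rw [modNCyclotomicCharacter_absGaloisRestrict, natCast_zsmul,
      modNCyclotomicCharacter_eq_toZModPow_cyclotomicCharacter]
    exact ordinaryReduction_inertia_smul_of_mem_kernelReduction_holds W ℓ v hℓv hgood hord σ hσ k Q
      hQk (AddSubgroup.mem_comap.mp hQ)
  · intro τ hτ Q hQk
    rw [inertia_adicCompletionPrime_eq_map_absInertia ℚ v] at hτ
    obtain ⟨σ, hσ, rfl⟩ := Subgroup.mem_map.mp hτ
    obtain ⟨φ, hφI, -, hφ⟩ :=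
      ordinaryReduction_exists_unramified_character_mod_kernelReduction_holds W ℓ v hℓv hgood hord
    have h := hφ σ k Q hQk
    rw [hφI σ hσ, Units.val_one, map_one] at h
    change absGaloisRestrict ℚ (v.adicCompletion ℚ) σ • Q - Q ∈ _
    rw [AddSubgroup.mem_comap]
    rcases Nat.eq_zero_or_pos k with rfl | hk
    · have hQ0 : Q = 0 := by simpa using hQk
      rw [hQ0, smul_zero, sub_zero, map_zero]
      exact AddSubgroup.zero_mem _
    · haveI : Fact (1 < ℓ ^ k) := ⟨Nat.one_lt_pow hk.ne' (Fact.out : ℓ.Prime).one_lt⟩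
      rwa [ZMod.val_one, one_smul] at h

/-- **D3′₀ (PROVED: D3loc of §2 + D-TRANS).**  The multiplicative container at `𝔓₀`. -/
theorem exists_multiplicativeFiltration_adicCompletionPrime (W : WeierstrassCurve ℚ) [W.IsElliptic]
    {v : HeightOneSpectrum (𝓞 ℚ)} (hv : W.HasMultiplicativeReductionAt v) {ℓ : ℕ} [Fact ℓ.Prime]
    (hℓv : (ℓ : 𝓞 ℚ) ∈ v.asIdeal) (k : ℕ) [NeZero ((ℓ ^ k : ℕ) : v.adicCompletion ℚ)] :
    ∃ E₁ : AddSubgroup (geomPoints W),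
      (∀ τ ∈ (adicCompletionPrime ℚ v).inertia (absoluteGaloisGroup ℚ), ∀ Q ∈ E₁, ℓ ^ k • Q = 0 →
        τ • Q = ((((modNCyclotomicCharacter ℚ (ℓ ^ k) τ : (ZMod (ℓ ^ k))ˣ) :
          ZMod (ℓ ^ k)).val : ℤ)) • Q) ∧
      (∀ τ ∈ (adicCompletionPrime ℚ v).inertia (absoluteGaloisGroup ℚ), ∀ Q : geomPoints W,
        ℓ ^ k • Q = 0 → τ • Q - Q ∈ E₁) := by
  haveI : NeZero (ℓ ^ k) := ⟨pow_ne_zero _ (Fact.out : ℓ.Prime).ne_zero⟩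
  obtain ⟨h1, h2⟩ := exists_multiplicativeContainer_local W hv hℓv k
  exact ⟨_, container_of_local W v (ℓ ^ k) (W.localKernelOfReduction v) h1 h2⟩

/-- D1 (g7 verbatim, proved): the Borel sandwich on one line. -/
theorem filtration_dichotomy {M : Type*} [AddCommGroup M] {ℓ k : ℕ} (hℓ : ℓ.Prime)
    (E₁ : AddSubgroup M) {ι : Type*} (τ : ι → M →+ M) (x y : ι → ℤ)
    (hx : ∀ i, ∀ Q ∈ E₁, ℓ ^ k • Q = 0 → τ i Q = x i • Q)
    (hy : ∀ i (Q : M), ℓ ^ k • Q = 0 → τ i Q - y i • Q ∈ E₁)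
    (i₀ : ι) (hi₀ : ¬ ((ℓ : ℤ) ∣ x i₀ - y i₀))
    {P : M} (hP : addOrderOf P = ℓ ^ k) (lam : ι → ℤ) (hlam : ∀ i, τ i P = lam i • P) :
    (∀ i, (ℓ : ℤ) ^ k ∣ lam i - y i) ∨ (∀ i, (ℓ : ℤ) ^ k ∣ lam i - x i) := by
  classical
  have hℓ0 : (ℓ : ℤ) ≠ 0 := by exact_mod_cast hℓ.ne_zero
  have hPk : ℓ ^ k • P = 0 := by rw [← hP]; exact addOrderOf_nsmul_eq_zero P
  have hPk' : ((ℓ ^ k : ℕ) : ℤ) • P = 0 := by rw [natCast_zsmul]; exact hPk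
  have hord : ∀ n : ℤ, n • P = 0 ↔ (ℓ : ℤ) ^ k ∣ n := fun n => by
    rw [← addOrderOf_dvd_iff_zsmul_eq_zero, hP, Int.natCast_pow]
  have hex : ∃ c : ℕ, ℓ ^ c • P ∈ E₁ := ⟨k, by rw [hPk]; exact E₁.zero_mem⟩
  obtain ⟨μ, hμmem, hμmin⟩ : ∃ μ : ℕ, ℓ ^ μ • P ∈ E₁ ∧ ∀ c : ℕ, ℓ ^ c • P ∈ E₁ → μ ≤ c :=
    ⟨Nat.find hex, Nat.find_spec hex, fun c hc => Nat.find_min' hex hc⟩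
  have hμk : μ ≤ k := hμmin k (by rw [hPk]; exact E₁.zero_mem)
  have hgen : ∀ n : ℤ, n • P ∈ E₁ → (ℓ : ℤ) ^ μ ∣ n := by
    intro n hn
    have hbez : ((Int.gcd n ((ℓ ^ k : ℕ) : ℤ) : ℕ) : ℤ) • P ∈ E₁ := by
      rw [Int.gcd_eq_gcd_ab n ((ℓ ^ k : ℕ) : ℤ), add_smul, mul_comm n, mul_smul,
        mul_comm ((ℓ ^ k : ℕ) : ℤ), mul_smul, hPk', smul_zero, add_zero]
      exact E₁.zsmul_mem hn _
    have hdvd : Int.gcd n ((ℓ ^ k : ℕ) : ℤ) ∣ ℓ ^ k :=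
      Int.natCast_dvd_natCast.mp (Int.gcd_dvd_right _ _)
    obtain ⟨c, -, hc⟩ := (Nat.dvd_prime_pow hℓ).mp hdvd
    have hμc : μ ≤ c := hμmin c (by rw [← hc, ← natCast_zsmul]; exact hbez)
    have hn' : ((Int.gcd n ((ℓ ^ k : ℕ) : ℤ) : ℕ) : ℤ) ∣ n := Int.gcd_dvd_left _ _
    rw [hc, Int.natCast_pow] at hn'
    exact (pow_dvd_pow _ hμc).trans hn'
  have hy' : ∀ i, (ℓ : ℤ) ^ μ ∣ lam i - y i := fun i => hgen _ (by
    rw [sub_smul, ← hlam]; exact hy i P hPk)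
  have hx' : ∀ i, (ℓ : ℤ) ^ (k - μ) ∣ lam i - x i := by
    intro i
    have h0 : ℓ ^ k • (ℓ ^ μ • P) = 0 := by rw [smul_comm, hPk, smul_zero]
    have h1 : τ i (ℓ ^ μ • P) = x i • (ℓ ^ μ • P) := hx i _ hμmem h0
    rw [map_nsmul, hlam] at h1
    have h2 : (((ℓ ^ μ : ℕ) : ℤ) * (lam i - x i)) • P = 0 := by
      rw [mul_sub, sub_smul, mul_comm _ (x i), mul_smul, mul_smul, natCast_zsmul, natCast_zsmul,
        h1, sub_self]
    have h3 : (ℓ : ℤ) ^ k ∣ ((ℓ ^ μ : ℕ) : ℤ) * (lam i - x i) := (hord _).mp h2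
    rw [Int.natCast_pow, ← Nat.sub_add_cancel hμk, pow_add, mul_comm ((ℓ : ℤ) ^ (k - μ))] at h3
    exact (mul_dvd_mul_iff_left (pow_ne_zero μ hℓ0)).mp h3
  rcases Nat.eq_zero_or_pos μ with hμ0 | hμpos
  · refine Or.inr fun i => ?_
    have := hx' i
    rwa [hμ0, Nat.sub_zero] at this
  · rcases hμk.eq_or_lt with hμk' | hμlt
    · exact Or.inl fun i => by rw [← hμk']; exact hy' i
    · exfalso
      refine hi₀ ?_
      have h1 : (ℓ : ℤ) ∣ lam i₀ - y i₀ := (dvd_pow_self (ℓ : ℤ) hμpos.ne').trans (hy' i₀)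
      have h2 : (ℓ : ℤ) ∣ lam i₀ - x i₀ :=
        (dvd_pow_self (ℓ : ℤ) (Nat.sub_pos_of_lt hμlt).ne').trans (hx' i₀)
      have h3 := dvd_sub h1 h2
      rwa [sub_sub_sub_cancel_left] at h3

/-- **SS′ (PROVED here; character form of g7's SS).**  A `Γ_ℚ`-stable line in `E[N]` with character
`r`, `N ≥ 3` a prime of good reduction of the global minimal model ⇒ the reduction at `N` is ORDINARY
(`N ∤ a_N`).  This is exactly the `exfalso` branch of
`Mazur1978.modEq_zero_or_one_of_hasGoodReductionAtPrime` (Serre 1972 §1.11 Prop. 12 c): at a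
supersingular `N` inertia acts through a cyclic group of order `N² − 1`, but a stable line makes
`τ^{N−1}` unipotent).  [cite: Serre1972, §1.11 Prop. 12 c)] [cite: Mazur1978, §5 proof of Prop. 5.1] -/
theorem not_dvd_frobeniusTrace_of_isogenyCharacter (W : WeierstrassCurve ℚ) [W.IsElliptic]
    [W.IsGloballyMinimal] (N : ℕ) [Fact N.Prime] (hN3 : 3 ≤ N)
    (hgood : W.HasGoodReductionAtPrime N) {P : geomTorsion W N} (hP0 : P ≠ 0)
    {r : absoluteGaloisGroup ℚ →* (ZMod N)ˣ}
    (hr : ∀ σ : absoluteGaloisGroup ℚ, σ • P = ((r σ : (ZMod N)ˣ) : ZMod N).val • P) :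
    ¬ ((N : ℤ) ∣ W.frobeniusTrace N) := by
  intro hord
  letI : Module (ZMod N) (geomTorsion W N) := AddSubgroup.torsionBy.zmodModule
  have hN : N.Prime := Fact.out
  haveI : NeZero N := ⟨hN.ne_zero⟩
  haveI : NeZero ((N : ℕ) : ℚ) := ⟨by exact_mod_cast hN.ne_zero⟩
  set v : HeightOneSpectrum (𝓞 ℚ) := primesEquiv.symm ⟨N, hN⟩ with hvdef
  have hv : (primesEquiv v : ℕ) = N := by rw [hvdef, Equiv.apply_symm_apply]
  obtain ⟨𝔓₀, hmem₀, h𝔓₀⟩ := exists_ideal_placeOver N hv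
  haveI := h𝔓₀.1
  have hΔ := not_dvd_minimalDiscriminantInt_of_hasGoodReductionAtPrime' W N hgood
  set χ : absoluteGaloisGroup ℚ →* (ZMod N)ˣ := modNCyclotomicCharacter ℚ N with hχ
  have hval : ∀ (c : ZMod N) (S : geomTorsion W N), c.val • S = c • S := fun c S ↦ by
    rw [← Nat.cast_smul_eq_nsmul (ZMod N), ZMod.natCast_zmod_val]
  have hrP : ∀ σ : absoluteGaloisGroup ℚ, σ • P = ((r σ : (ZMod N)ˣ) : ZMod N) • P := fun σ ↦ by
    rw [hr σ, hval]
  have hN2 : N ≠ 2 := by omega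
  have hm : 0 < N ^ 2 - 1 := by
    have : 4 ≤ N ^ 2 := by nlinarith [hN.two_le]
    omega
  obtain ⟨hcyc, hcard⟩ := isCyclic_and_card_inertia_map_of_dvd_frobeniusTrace N hΔ hord hN2
    hmem₀ (fun π ζ hπ hζ ↦ exists_mem_inertia_smul_eq_mul_of_pow_eq N hm hv h𝔓₀ hπ hζ)
  set G : Subgroup (Multiplicative (AddAut (geomTorsion W N))) :=
    (𝔓₀.inertia (absoluteGaloisGroup ℚ)).map (galoisRepTorsion W N) with hG
  -- every element of the image of inertia has order dividing `N (N − 1)`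
  have hexp : ∀ x : G, x ^ (N * (N - 1)) = 1 := by
    rintro ⟨_, τ, hτ, rfl⟩
    apply Subtype.ext
    change (galoisRepTorsion W N τ) ^ (N * (N - 1)) = 1
    rw [← map_pow, galoisRepTorsion_eq_one_iff', mul_comm, pow_mul]
    set σ := τ ^ (N - 1) with hσ
    have hσI : σ ∈ 𝔓₀.inertia (absoluteGaloisGroup ℚ) := Subgroup.pow_mem _ hτ _
    have hrσ : r σ = 1 := by rw [hσ, map_pow, ZMod.units_pow_card_sub_one_eq_one]
    have hχσ : χ σ = 1 := by rw [hσ, map_pow, ZMod.units_pow_card_sub_one_eq_one]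
    have hσP : σ • P = P := by rw [hrP, hrσ, Units.val_one, one_smul]
    refine Mazur1978.pow_smul_eq_self_of_sub_mem_zmultiples W N σ hσP (fun S ↦ ?_)
    have h := Mazur1978.smul_sub_smul_mem_zmultiples_of_isogenyCharacter W N hP0 hr σ S
    rwa [modPCyclotomicCharacterZMod_eq_modNCyclotomicCharacter, ← hχ, hχσ, hrσ, inv_one,
      Units.val_one, mul_one, ZMod.val_one, one_smul] at h
  obtain ⟨x, hx⟩ := hcyc.exists_generator
  have hox : orderOf x = N ^ 2 - 1 := by rw [orderOf_eq_card_of_forall_mem_zpowers hx, hcard]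
  have hdvd : N ^ 2 - 1 ∣ N * (N - 1) := by
    rw [← hox]
    exact orderOf_dvd_of_pow_eq_one (hexp x)
  have h1 : N + 1 ∣ N * (N - 1) := by
    refine dvd_trans ⟨N - 1, ?_⟩ hdvd
    zify [show 1 ≤ N by omega, show 1 ≤ N ^ 2 by nlinarith]
    ring
  have hcop : Nat.Coprime (N + 1) N := by
    rw [Nat.coprime_comm, Nat.coprime_self_add_right]
    exact Nat.coprime_one_right N
  have h2 : N + 1 ∣ N - 1 := hcop.dvd_of_dvd_mul_left h1
  have h3 := Nat.le_of_dvd (by omega) h2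
  omega

/-- **H2 (PROVED here).**  A two-clause container at `𝔓` for the inertia group `I_𝔓` (`𝔓 ∣ ℓ`,
`ℓ` odd, `k ≥ 1`) forces the character of a stable cyclic line of order `ℓᵏ` to be EXACTLY `1` or
EXACTLY `χ_{ℓᵏ}` on `I_𝔓`: D1 with `x := χ(τ).val`, `y := 1`, `lam := r(τ).val`, witness `τ₀ ∈ I_𝔓`
with `χ_{ℓᵏ}(τ₀) = 2` (`exists_mem_inertia_modNCyclotomicCharacter_eq`; `2 − 1 = 1` is prime to `ℓ`). -/
theorem eq_one_or_eq_cyclotomic_of_container (W : WeierstrassCurve ℚ) [W.IsElliptic]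
    {ℓ k : ℕ} [Fact ℓ.Prime] (hℓ2 : ℓ ≠ 2) (hk : 1 ≤ k)
    {v : HeightOneSpectrum (𝓞 ℚ)} (hℓv : (ℓ : 𝓞 ℚ) ∈ v.asIdeal)
    {𝔓 : Ideal (absIntegers (𝓞 ℚ) ℚ)} (h𝔓 : 𝔓 ∈ v.primesAbove)
    (E₁ : AddSubgroup (geomPoints W))
    (h1 : ∀ τ ∈ 𝔓.inertia (absoluteGaloisGroup ℚ), ∀ Q ∈ E₁, ℓ ^ k • Q = 0 →
        τ • Q = ((((modNCyclotomicCharacter ℚ (ℓ ^ k) τ : (ZMod (ℓ ^ k))ˣ) :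
          ZMod (ℓ ^ k)).val : ℤ)) • Q)
    (h2 : ∀ τ ∈ 𝔓.inertia (absoluteGaloisGroup ℚ), ∀ Q : geomPoints W, ℓ ^ k • Q = 0 →
        τ • Q - Q ∈ E₁)
    {P : geomPoints W} (hP : addOrderOf P = ℓ ^ k)
    {r : absoluteGaloisGroup ℚ →* (ZMod (ℓ ^ k))ˣ}
    (hr : ∀ σ : absoluteGaloisGroup ℚ, σ • P = ((r σ : (ZMod (ℓ ^ k))ˣ) : ZMod (ℓ ^ k)).val • P) :
    (∀ τ ∈ 𝔓.inertia (absoluteGaloisGroup ℚ), r τ = 1) ∨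
      (∀ τ ∈ 𝔓.inertia (absoluteGaloisGroup ℚ), r τ = modNCyclotomicCharacter ℚ (ℓ ^ k) τ) := by
  have hℓ : ℓ.Prime := Fact.out
  haveI : NeZero (ℓ ^ k) := ⟨pow_ne_zero _ hℓ.ne_zero⟩
  have hℓ3 : 3 ≤ ℓ := by
    rcases hℓ.eq_two_or_odd' with h | h
    · exact absurd h hℓ2
    · have := hℓ.two_le; omega
  have hlt2 : 2 < ℓ ^ k := lt_of_lt_of_le (by omega) (Nat.le_self_pow (by omega) ℓ |>.trans
    (Nat.pow_le_pow_right hℓ.pos hk))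
  set I := 𝔓.inertia (absoluteGaloisGroup ℚ) with hI
  set χ := modNCyclotomicCharacter ℚ (ℓ ^ k) with hχ
  -- the witness `τ₀ ∈ I` with `χ(τ₀) = 2`
  have hcop : Nat.Coprime 2 (ℓ ^ k) := (Nat.coprime_pow_right_iff hk _ _).mpr
    ((Nat.coprime_primes Nat.prime_two hℓ).mpr (Ne.symm hℓ2))
  set a : (ZMod (ℓ ^ k))ˣ := ZMod.unitOfCoprime 2 hcop with ha
  have hkm : ℓ ^ k = ℓ ^ (k - 1 + 1) * 1 := by rw [Nat.sub_add_cancel hk, mul_one]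
  obtain ⟨τ₀, hτ₀I, hτ₀⟩ := exists_mem_inertia_modNCyclotomicCharacter_eq (m := ℓ ^ k) (p := ℓ)
    (k := k - 1) (d := 1) hkm (fun h1 => hℓ.one_lt.ne' (Nat.dvd_one.mp h1))
    (natGenerator_eq_of_natCast_mem v hℓ hℓv) h𝔓 (a := a) (Subsingleton.elim _ _)
  have haval : ((a : (ZMod (ℓ ^ k))ˣ) : ZMod (ℓ ^ k)).val = 2 := by
    rw [ha, ZMod.coe_unitOfCoprime, ZMod.val_natCast, Nat.mod_eq_of_lt hlt2]
  -- D1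
  have hD := filtration_dichotomy (M := geomPoints W) hℓ E₁ (ι := I)
    (fun i => DistribSMul.toAddMonoidHom (geomPoints W) (i : absoluteGaloisGroup ℚ))
    (fun i => (((χ i : (ZMod (ℓ ^ k))ˣ) : ZMod (ℓ ^ k)).val : ℤ)) (fun _ => 1)
    (fun i Q hQ hQk => h1 i i.2 Q hQ hQk)
    (fun i Q hQk => by rw [one_zsmul]; exact h2 i i.2 Q hQk)
    ⟨τ₀, hτ₀I⟩ (by
      change ¬ ((ℓ : ℤ) ∣ (((χ τ₀ : (ZMod (ℓ ^ k))ˣ) : ZMod (ℓ ^ k)).val : ℤ) - 1)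
      rw [← hχ] at hτ₀
      rw [hτ₀, haval]
      norm_num
      intro h
      exact hℓ.one_lt.ne' (by exact_mod_cast Int.eq_one_of_dvd_one (by positivity) h))
    hP (fun i => (((r i : (ZMod (ℓ ^ k))ˣ) : ZMod (ℓ ^ k)).val : ℤ))
    (fun i => by
      change (i : absoluteGaloisGroup ℚ) • P = _
      rw [hr, natCast_zsmul])
  -- read the divisibilities back in `(ZMod ℓᵏ)ˣ`
  have hread : ∀ (u w : (ZMod (ℓ ^ k))ˣ),
      (ℓ : ℤ) ^ k ∣ (((u : ZMod (ℓ ^ k)).val : ℤ)) - (((w : ZMod (ℓ ^ k)).val : ℤ)) → u = w := by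
    intro u w h
    have h' : ((((w : ZMod (ℓ ^ k)).val : ℤ) : ZMod (ℓ ^ k))) =
        ((((u : ZMod (ℓ ^ k)).val : ℤ) : ZMod (ℓ ^ k))) := by
      rw [ZMod.intCast_eq_intCast_iff_dvd_sub]
      exact_mod_cast h
    apply Units.ext
    rw [Int.cast_natCast, Int.cast_natCast, ZMod.natCast_zmod_val, ZMod.natCast_zmod_val] at h'
    exact h'.symm
  rcases hD with hD | hD
  · left
    intro τ hτ
    have h := hD ⟨τ, hτ⟩
    haveI : Fact (1 < ℓ ^ k) := ⟨by omega⟩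
    refine hread (r τ) 1 ?_
    rw [Units.val_one, ZMod.val_one, Nat.cast_one]
    exact h
  · right
    intro τ hτ
    exact hread (r τ) (χ τ) (hD ⟨τ, hτ⟩)

/-- **LOCℓ (PROVED here, g7/g9 signature verbatim).**  `W` globally minimal, semistable at `v ∣ ℓ`,
`ℓ` odd, `k ≥ 1`: the character of a stable cyclic line of order `ℓᵏ` is EXACTLY `1` or EXACTLY
`χ_{ℓᵏ}` on `I_𝔓` for every `𝔓 ∣ ℓ`.  Multiplicative ⇒ D3′₀; good ⇒ SS′ on `ℓ^{k−1}P` excludes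
supersingular, then D2₀; H2 at `𝔓₀`; CONJ moves to `𝔓`. -/
theorem cyclicCharacter_eq_one_or_eq_cyclotomic_at_ell (W : WeierstrassCurve ℚ) [W.IsElliptic]
    [W.IsGloballyMinimal] (ℓ k : ℕ) [Fact ℓ.Prime] (hℓ2 : ℓ ≠ 2) (hk : 1 ≤ k)
    {v : HeightOneSpectrum (𝓞 ℚ)} (hℓv : (ℓ : 𝓞 ℚ) ∈ v.asIdeal) (hss : W.IsSemistableAt v)
    {P : geomPoints W} (hP : addOrderOf P = ℓ ^ k)
    {r : absoluteGaloisGroup ℚ →* (ZMod (ℓ ^ k))ˣ}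
    (hr : ∀ σ : absoluteGaloisGroup ℚ, σ • P = ((r σ : (ZMod (ℓ ^ k))ˣ) : ZMod (ℓ ^ k)).val • P)
    {𝔓 : Ideal (absIntegers (𝓞 ℚ) ℚ)} (h𝔓 : 𝔓 ∈ v.primesAbove) :
    (∀ τ ∈ 𝔓.inertia (absoluteGaloisGroup ℚ), r τ = 1) ∨
      (∀ τ ∈ 𝔓.inertia (absoluteGaloisGroup ℚ), r τ = modNCyclotomicCharacter ℚ (ℓ ^ k) τ) := by
  have hℓ : ℓ.Prime := Fact.out
  haveI : NeZero (ℓ ^ k) := ⟨pow_ne_zero _ hℓ.ne_zero⟩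
  haveI : NeZero ((ℓ ^ k : ℕ) : v.adicCompletion ℚ) :=
    NeZero.nat_of_injective (algebraMap ℚ (v.adicCompletion ℚ)).injective
  have hℓ3 : 3 ≤ ℓ := by
    rcases hℓ.eq_two_or_odd' with h | h
    · exact absurd h hℓ2
    · have := hℓ.two_le; omega
  have h𝔓₀ := adicCompletionPrime_mem_primesAbove ℚ v
  -- the container at `𝔓₀`
  obtain ⟨E₁, h1, h2⟩ : ∃ E₁ : AddSubgroup (geomPoints W),
      (∀ τ ∈ (adicCompletionPrime ℚ v).inertia (absoluteGaloisGroup ℚ), ∀ Q ∈ E₁, ℓ ^ k • Q = 0 →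
        τ • Q = ((((modNCyclotomicCharacter ℚ (ℓ ^ k) τ : (ZMod (ℓ ^ k))ˣ) :
          ZMod (ℓ ^ k)).val : ℤ)) • Q) ∧
      (∀ τ ∈ (adicCompletionPrime ℚ v).inertia (absoluteGaloisGroup ℚ), ∀ Q : geomPoints W,
        ℓ ^ k • Q = 0 → τ • Q - Q ∈ E₁) := by
    rcases hss with hgood | hmult
    · -- good reduction: SS′ on `ℓ^{k-1} P` excludes supersingular, then D2₀
      have hgoodℓ : W.HasGoodReductionAtPrime ℓ := W.hasGoodReductionAtPrime_of_hasGoodReductionAt v hℓv hgood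
      -- `Q := ℓ^{k-1} P ∈ E[ℓ]`, nonzero, with character `r mod ℓ`
      have hℓQ : ℓ • (ℓ ^ (k - 1) • P) = 0 := by
        rw [← mul_nsmul', ← pow_succ', Nat.sub_add_cancel hk, ← hP]; exact addOrderOf_nsmul_eq_zero P
      have hQmem : ℓ ^ (k - 1) • P ∈ geomTorsion W ℓ := by
        refine (mem_torsionPoints_iff _ _ _).mpr ?_
        rw [natCast_zsmul]
        exact hℓQ
      set Q : geomTorsion W ℓ := ⟨ℓ ^ (k - 1) • P, hQmem⟩ with hQdef
      have hQ0 : Q ≠ 0 := by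
        intro h0
        have h0' : ℓ ^ (k - 1) • P = 0 := by
          have := congrArg Subtype.val h0
          simpa [hQdef] using this
        have hd : ℓ ^ k ∣ ℓ ^ (k - 1) := by rw [← hP]; exact addOrderOf_dvd_of_nsmul_eq_zero h0'
        have := (Nat.pow_dvd_pow_iff_le_right hℓ.one_lt).mp hd
        omega
      have hdvd : ℓ ∣ ℓ ^ k := dvd_pow_self ℓ (by omega)
      set r₁ : absoluteGaloisGroup ℚ →* (ZMod ℓ)ˣ := (ZMod.unitsMap hdvd).comp r with hr₁def
      have hr₁ : ∀ σ : absoluteGaloisGroup ℚ, σ • Q = ((r₁ σ : (ZMod ℓ)ˣ) : ZMod ℓ).val • Q := by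
        intro σ
        apply Subtype.ext
        rw [AddSubgroup.torsionBy.coe_smul, AddSubgroupClass.coe_nsmul]
        change σ • (ℓ ^ (k - 1) • P) = ((r₁ σ : (ZMod ℓ)ˣ) : ZMod ℓ).val • (ℓ ^ (k - 1) • P)
        have hcast : (((r₁ σ : (ZMod ℓ)ˣ) : ZMod ℓ)) =
            ZMod.castHom hdvd (ZMod ℓ) ((r σ : (ZMod (ℓ ^ k))ˣ) : ZMod (ℓ ^ k)) := rfl
        rw [smul_comm, hr σ, smul_comm, hcast, ZMod.castHom_apply, ZMod.cast_eq_val, ZMod.val_natCast,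
          ← nsmul_eq_mod_nsmul _ hℓQ]
      have hord := not_dvd_frobeniusTrace_of_isogenyCharacter W ℓ hℓ3 hgoodℓ hQ0 hr₁
      have hord' : ¬ ((ℓ : ℤ) ∣ W.frobeniusTraceAt v) := by
        rw [frobeniusTraceAt_eq_frobeniusTrace]
        have hpe : (primesEquiv v : ℕ) = ℓ := primesEquiv_eq_of_natCast_mem v hℓ hℓv
        rwa [hpe]
      exact exists_ordinaryFiltration_adicCompletionPrime W hgood hℓv hord' k
    · exact exists_multiplicativeFiltration_adicCompletionPrime W hmult hℓv k
  -- dichotomy at `𝔓₀`, then CONJ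
  rcases eq_one_or_eq_cyclotomic_of_container W hℓ2 hk hℓv h𝔓₀ E₁ h1 h2 hP hr with h | h
  · left
    intro τ hτ
    have := eqOn_inertia_of_eqOn_inertia_one r 1 v h𝔓₀ (by simpa using h) h𝔓 hτ
    simpa using this
  · right
    intro τ hτ
    exact eqOn_inertia_of_eqOn_inertia_one r (modNCyclotomicCharacter ℚ (ℓ ^ k)) v h𝔓₀ h h𝔓 hτ

end LOCell


/-! ## §6 GLOB⁻ ASSEMBLED (gen 11): LOC (g9: T1⁺ + T2, T2 now PROVED §4) + LOCℓ (§5) + OPEN + Minkowski -/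

section GLOB

open Rat.HeightOneSpectrum

/-- T1⁺ (g9 verbatim, proved). -/
theorem cyclicCharacter_pow_twelve_eq_one_of_valuation_j_le_one (W : WeierstrassCurve ℚ)
    [W.IsElliptic] {m : ℕ} [NeZero m] {P : geomPoints W} (hP : addOrderOf P = m)
    {r : absoluteGaloisGroup ℚ →* (ZMod m)ˣ}
    (hr : ∀ σ : absoluteGaloisGroup ℚ, σ • P = ((r σ : (ZMod m)ˣ) : ZMod m).val • P)
    {v : HeightOneSpectrum (𝓞 ℚ)} (hmv : (m : 𝓞 ℚ) ∉ v.asIdeal) (hj : v.valuation ℚ W.j ≤ 1)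
    {𝔓 : Ideal (absIntegers (𝓞 ℚ) ℚ)} (h𝔓 : 𝔓 ∈ v.primesAbove)
    {τ : absoluteGaloisGroup ℚ} (hτ : τ ∈ 𝔓.inertia (absoluteGaloisGroup ℚ)) :
    r τ ^ 12 = 1 := by
  have hmP : m • P = 0 := by rw [← hP]; exact addOrderOf_nsmul_eq_zero P
  have h12 : τ ^ 12 • P = P := by
    by_cases h3 : (3 : 𝓞 ℚ) ∈ v.asIdeal
    · have h2 : (2 : 𝓞 ℚ) ∉ v.asIdeal := by
        intro h2
        have h1 : (1 : 𝓞 ℚ) ∈ v.asIdeal := by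
          have h := v.asIdeal.sub_mem h3 h2
          norm_num at h
          exact h
        exact v.isPrime.ne_top ((Ideal.eq_top_iff_one _).mpr h1)
      exact Mazur1978.pow_twelve_smul_eq_of_mem_inertia_of_valuation_j_le_one W h2 hj h𝔓 hτ hmv hmP
    · exact Mazur1978.pow_twelve_smul_eq_of_mem_inertia_of_valuation_j_le_one_of_three W h3 hj h𝔓 hτ
        hmv hmP
  have h' : ((r (τ ^ 12) : (ZMod m)ˣ) : ZMod m).val • P = P := by rw [← hr]; exact h12
  have h1 : ((r (τ ^ 12) : (ZMod m)ˣ) : ZMod m) = 1 :=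
    Mazur1978.eq_one_of_val_smul_eq_of_addOrderOf W hP h'
  rw [map_pow] at h1
  exact Units.val_eq_one.mp h1

/-- **LOC (g9 statement; PROVED — unconditionally now that T2 (§4) is).**  At every place `v ∤ ℓ`, the
half-level character of a stable cyclic line of order `ℓᵏ` satisfies `r̄(τ)¹² = 1` on inertia. -/
theorem unitsMap_cyclicCharacter_pow_twelve_eq_one (W : WeierstrassCurve ℚ) [W.IsElliptic]
    {ℓ k : ℕ} [Fact ℓ.Prime] (hk : 1 ≤ k) {P : geomPoints W} (hP : addOrderOf P = ℓ ^ k)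
    {r : absoluteGaloisGroup ℚ →* (ZMod (ℓ ^ k))ˣ}
    (hr : ∀ σ : absoluteGaloisGroup ℚ, σ • P = ((r σ : (ZMod (ℓ ^ k))ˣ) : ZMod (ℓ ^ k)).val • P)
    {v : HeightOneSpectrum (𝓞 ℚ)} (hℓv : (ℓ : 𝓞 ℚ) ∉ v.asIdeal)
    {𝔓 : Ideal (absIntegers (𝓞 ℚ) ℚ)} (h𝔓 : 𝔓 ∈ v.primesAbove)
    {τ : absoluteGaloisGroup ℚ} (hτ : τ ∈ 𝔓.inertia (absoluteGaloisGroup ℚ)) :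
    ZMod.unitsMap (pow_halfCeil_dvd ℓ k) (r τ) ^ 12 = 1 := by
  haveI : NeZero (ℓ ^ k) := ⟨pow_ne_zero _ (Fact.out : ℓ.Prime).ne_zero⟩
  rcases le_or_gt (v.valuation ℚ W.j) 1 with hj | hj
  · have hmv : ((ℓ ^ k : ℕ) : 𝓞 ℚ) ∉ v.asIdeal := by
      rw [Nat.cast_pow]
      exact fun h => hℓv (v.isPrime.mem_of_pow_mem k h)
    have h12 := cyclicCharacter_pow_twelve_eq_one_of_valuation_j_le_one W hP hr hmv hj h𝔓 hτ
    rw [← map_pow, h12, map_one]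
  · have h2 := unitsMap_cyclicCharacter_sq_eq_one_of_one_lt_valuation_j W hj hℓv hk hP hr h𝔓 hτ
    calc ZMod.unitsMap (pow_halfCeil_dvd ℓ k) (r τ) ^ 12
        = (ZMod.unitsMap (pow_halfCeil_dvd ℓ k) (r τ) ^ 2) ^ 6 := by rw [← pow_mul]
      _ = 1 := by rw [h2, one_pow]

/-- OPEN (g9 verbatim, proved): the character of a stable cyclic line has open kernel. -/
theorem isOpen_ker_of_smul_eq_of_addOrderOf (W : WeierstrassCurve ℚ) [W.IsElliptic] {m : ℕ}
    [NeZero m] {P : geomPoints W} (hP : addOrderOf P = m)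
    {r : absoluteGaloisGroup ℚ →* (ZMod m)ˣ}
    (hr : ∀ σ : absoluteGaloisGroup ℚ, σ • P = ((r σ : (ZMod m)ˣ) : ZMod m).val • P) :
    IsOpen ((r.ker : Subgroup (absoluteGaloisGroup ℚ)) : Set (absoluteGaloisGroup ℚ)) := by
  refine Subgroup.isOpen_mono (H₁ := MulAction.stabilizer (absoluteGaloisGroup ℚ) P) ?_
    (isOpen_stabilizer_point_holds W P)
  intro σ hσ
  rw [MulAction.mem_stabilizer_iff] at hσ
  rw [MonoidHom.mem_ker]
  have hfix : ((r σ : (ZMod m)ˣ) : ZMod m).val • P = P := by rw [← hr σ]; exact hσ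
  exact Units.val_eq_one.mp (Mazur1978.eq_one_of_val_smul_eq_of_addOrderOf W hP hfix)

/-- **GLOB⁻ (PROVED here, g9 signature verbatim).**  `W` globally minimal, semistable above `ℓ`,
`ℓ` odd, `k ≥ 1`, `ℤP` stable of order `ℓᵏ` with character `r`; `r̄ := r mod ℓ^⌈k/2⌉`,
`χ̄ := χ_{ℓ^⌈k/2⌉}`.  Then `r̄¹² = 1` OR `r̄¹² = χ̄¹²` on all of `Γ_ℚ`: LOCℓ (§5) picks the branch at the
place of `ℓ`, `ψ := r̄¹²` resp. `((r·χ⁻¹) mod ℓ^⌈k/2⌉)¹²` is trivial on every inertia group (LOC off `ℓ`,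
`χ` unramified off `ℓ`, CONJ above `ℓ`), has open kernel (OPEN, `isOpen_ker_modNCyclotomicCharacter`),
hence is trivial (Minkowski: `Mazur1978.monoidHom_eq_one_of_forall_inertia`). -/
theorem unitsMap_cyclicCharacter_pow_twelve_dichotomy (W : WeierstrassCurve ℚ) [W.IsElliptic]
    [W.IsGloballyMinimal] (ℓ k : ℕ) [Fact ℓ.Prime] (hℓ2 : ℓ ≠ 2) (hk : 1 ≤ k)
    (hss : ∀ v : HeightOneSpectrum (𝓞 ℚ), (ℓ : 𝓞 ℚ) ∈ v.asIdeal → W.IsSemistableAt v)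
    {P : geomPoints W} (hP : addOrderOf P = ℓ ^ k)
    {r : absoluteGaloisGroup ℚ →* (ZMod (ℓ ^ k))ˣ}
    (hr : ∀ σ : absoluteGaloisGroup ℚ, σ • P = ((r σ : (ZMod (ℓ ^ k))ˣ) : ZMod (ℓ ^ k)).val • P) :
    (∀ σ : absoluteGaloisGroup ℚ, ZMod.unitsMap (pow_halfCeil_dvd ℓ k) (r σ) ^ 12 = 1) ∨
      (∀ σ : absoluteGaloisGroup ℚ, ZMod.unitsMap (pow_halfCeil_dvd ℓ k) (r σ) ^ 12 =
        modNCyclotomicCharacter ℚ (ℓ ^ halfCeil k) σ ^ 12) := by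
  have hℓ : ℓ.Prime := Fact.out
  haveI : NeZero (ℓ ^ k) := ⟨pow_ne_zero _ hℓ.ne_zero⟩
  haveI : NeZero (ℓ ^ halfCeil k) := ⟨pow_ne_zero _ hℓ.ne_zero⟩
  -- the place `v₀` of `ℓ` and the prime `𝔓₀` of `ℚ̄` above it
  set v₀ : HeightOneSpectrum (𝓞 ℚ) := primesEquiv.symm ⟨ℓ, hℓ⟩ with hv₀def
  have hv₀ : (primesEquiv v₀ : ℕ) = ℓ := by rw [hv₀def, Equiv.apply_symm_apply]
  have hgen : natGenerator v₀ = ℓ := hv₀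
  have hℓv₀ : (ℓ : 𝓞 ℚ) ∈ v₀.asIdeal := by
    have h := natCast_natGenerator_mem v₀
    rwa [hgen] at h
  have huniq : ∀ v : HeightOneSpectrum (𝓞 ℚ), (ℓ : 𝓞 ℚ) ∈ v.asIdeal → v = v₀ := fun v hv =>
    primesEquiv.injective (Subtype.ext ((primesEquiv_eq_of_natCast_mem v hℓ hv).trans hv₀.symm))
  have h𝔓₀ := adicCompletionPrime_mem_primesAbove ℚ v₀
  -- LOC off `ℓ`, OPEN
  have hloc : ∀ v : HeightOneSpectrum (𝓞 ℚ), (ℓ : 𝓞 ℚ) ∉ v.asIdeal → ∀ 𝔓 ∈ v.primesAbove,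
      ∀ τ ∈ 𝔓.inertia (absoluteGaloisGroup ℚ), ZMod.unitsMap (pow_halfCeil_dvd ℓ k) (r τ) ^ 12 = 1 :=
    fun v hv 𝔓 h𝔓 τ hτ => unitsMap_cyclicCharacter_pow_twelve_eq_one W hk hP hr hv h𝔓 hτ
  have hker := isOpen_ker_of_smul_eq_of_addOrderOf W hP hr
  rcases cyclicCharacter_eq_one_or_eq_cyclotomic_at_ell W ℓ k hℓ2 hk hℓv₀ (hss v₀ hℓv₀) hP hr h𝔓₀
    with hA | hB
  · left
    set ψ : absoluteGaloisGroup ℚ →* (ZMod (ℓ ^ halfCeil k))ˣ :=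
      (powMonoidHom 12).comp ((ZMod.unitsMap (pow_halfCeil_dvd ℓ k)).comp r) with hψ
    have hψ' : ∀ σ, ψ σ = ZMod.unitsMap (pow_halfCeil_dvd ℓ k) (r σ) ^ 12 := fun σ => rfl
    have hψker : IsOpen ((ψ.ker : Subgroup (absoluteGaloisGroup ℚ)) : Set (absoluteGaloisGroup ℚ)) := by
      refine Subgroup.isOpen_mono (H₁ := r.ker) ?_ hker
      intro σ hσ
      rw [MonoidHom.mem_ker] at hσ ⊢
      rw [hψ', hσ, map_one, one_pow]
    have hψI : ∀ (v : HeightOneSpectrum (𝓞 ℚ)), ∀ 𝔓 ∈ v.primesAbove,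
        ∀ τ ∈ 𝔓.inertia (absoluteGaloisGroup ℚ), ψ τ = 1 := by
      intro v 𝔓 h𝔓 τ hτ
      by_cases hv : (ℓ : 𝓞 ℚ) ∈ v.asIdeal
      · obtain rfl := huniq v hv
        have h1 : r τ = 1 := by
          have := eqOn_inertia_of_eqOn_inertia_one r 1 _ h𝔓₀ (by simpa using hA) h𝔓 hτ
          simpa using this
        rw [hψ', h1, map_one, one_pow]
      · rw [hψ']; exact hloc v hv 𝔓 h𝔓 τ hτ
    have hψ1 := Mazur1978.monoidHom_eq_one_of_forall_inertia ψ hψker hψI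
    intro σ
    have h1 := DFunLike.congr_fun hψ1 σ
    rw [MonoidHom.one_apply, hψ'] at h1
    exact h1
  · right
    set χ : absoluteGaloisGroup ℚ →* (ZMod (ℓ ^ k))ˣ := modNCyclotomicCharacter ℚ (ℓ ^ k) with hχ
    set ψ : absoluteGaloisGroup ℚ →* (ZMod (ℓ ^ halfCeil k))ˣ :=
      (powMonoidHom 12).comp ((ZMod.unitsMap (pow_halfCeil_dvd ℓ k)).comp (r * χ⁻¹)) with hψ
    have hψ' : ∀ σ, ψ σ = (ZMod.unitsMap (pow_halfCeil_dvd ℓ k) (r σ) *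
        (ZMod.unitsMap (pow_halfCeil_dvd ℓ k) (χ σ))⁻¹) ^ 12 := by
      intro σ
      change (ZMod.unitsMap (pow_halfCeil_dvd ℓ k) ((r * χ⁻¹) σ)) ^ 12 = _
      rw [MonoidHom.mul_apply, MonoidHom.inv_apply, map_mul, map_inv]
    have hχbar : ∀ σ, ZMod.unitsMap (pow_halfCeil_dvd ℓ k) (χ σ) =
        modNCyclotomicCharacter ℚ (ℓ ^ halfCeil k) σ :=
      fun σ => Mazur1978.unitsMap_modNCyclotomicCharacter _ σ
    have hψker : IsOpen ((ψ.ker : Subgroup (absoluteGaloisGroup ℚ)) : Set (absoluteGaloisGroup ℚ)) := by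
      refine Subgroup.isOpen_mono (H₁ := r.ker ⊓ χ.ker) ?_ ?_
      · intro σ hσ
        rw [Subgroup.mem_inf, MonoidHom.mem_ker, MonoidHom.mem_ker] at hσ
        rw [MonoidHom.mem_ker, hψ', hσ.1, hσ.2, map_one, inv_one, mul_one, one_pow]
      · rw [Subgroup.coe_inf]
        exact hker.inter (Mazur1978.isOpen_ker_modNCyclotomicCharacter (ℓ ^ k))
    have hψI : ∀ (v : HeightOneSpectrum (𝓞 ℚ)), ∀ 𝔓 ∈ v.primesAbove,
        ∀ τ ∈ 𝔓.inertia (absoluteGaloisGroup ℚ), ψ τ = 1 := by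
      intro v 𝔓 h𝔓 τ hτ
      haveI := h𝔓.1
      by_cases hv : (ℓ : 𝓞 ℚ) ∈ v.asIdeal
      · obtain rfl := huniq v hv
        have h1 : r τ = χ τ := eqOn_inertia_of_eqOn_inertia_one r χ _ h𝔓₀ hB h𝔓 hτ
        rw [hψ', h1, mul_inv_cancel, one_pow]
      · have hmv : ((ℓ ^ k : ℕ) : 𝓞 ℚ) ∉ v.asIdeal := by
          rw [Nat.cast_pow]
          exact fun h => hv (v.isPrime.mem_of_pow_mem k h)
        have hχ1 : χ τ = 1 :=
          modNCyclotomicCharacter_eq_one_of_mem_inertia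
            (Mazur1978.natCast_not_mem_of_not_mem_asIdeal hmv h𝔓) hτ
        rw [hψ', hχ1, map_one, inv_one, mul_one]
        exact hloc v hv 𝔓 h𝔓 τ hτ
    have hψ1 := Mazur1978.monoidHom_eq_one_of_forall_inertia ψ hψker hψI
    intro σ
    have h1 := DFunLike.congr_fun hψ1 σ
    rw [MonoidHom.one_apply, hψ', hχbar σ, mul_pow, inv_pow, mul_inv_eq_one] at h1
    exact h1

end GLOB


/-! ## §7 THE FROBENIUS END (gen 11): H5⁻ and G0 PROVED (g9 signatures verbatim) -/

section Frobenius

open Rat.HeightOneSpectrum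

/-- `n₁₂(p) = p¹² + 1 − s₁₂(a_p, p) = #Ẽ(𝔽_{p¹²})` (g7/g9 verbatim). -/
noncomputable def frobNorm (W : WeierstrassCurve ℚ) [W.IsGloballyMinimal] (p : ℕ) : ℤ :=
  (p : ℤ) ^ 12 + 1 - Mazur1978.frobTracePow (W.frobeniusTrace p) p 12

/-- A1 (PROVED, g4–g9 verbatim): a root `t` of `X² − aX + p` in `ℤ/n` (`p` a unit) with `t¹² = 1` OR
`t¹² = p¹²` forces `n ∣ p¹² + 1 − s₁₂(a,p)`. -/
theorem natCast_dvd_frobNorm_of_pow_twelve {n p : ℕ} [NeZero n] (a : ℤ) (hp : IsUnit (p : ZMod n))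
    {t : ZMod n} (hroot : t ^ 2 - (a : ZMod n) * t + (p : ZMod n) = 0)
    (ht : t ^ 12 = 1 ∨ t ^ 12 = (p : ZMod n) ^ 12) :
    (n : ℤ) ∣ (p : ℤ) ^ 12 + 1 - Mazur1978.frobTracePow a p 12 := by
  have hprod' : t * ((a : ZMod n) - t) = (p : ZMod n) := by
    linear_combination (-1 : ZMod n) * hroot
  have hsum : t + ((a : ZMod n) - t) = ((a : ℤ) : ZMod n) := by ring
  have hprod : t * ((a : ZMod n) - t) = (((p : ℕ) : ℤ) : ZMod n) := by
    rw [hprod', Int.cast_natCast]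
  have hspec := Mazur1978.frobTracePow_spec hsum hprod 12
  have h12 : ((a : ZMod n) - t) ^ 12 * t ^ 12 = (p : ZMod n) ^ 12 := by
    rw [← mul_pow, mul_comm, hprod']
  rw [← ZMod.intCast_zmod_eq_zero_iff_dvd]
  push_cast
  rw [← hspec]
  rcases ht with h1 | h2
  · rw [h1, mul_one] at h12
    rw [h1, h12]; ring
  · rw [h2] at h12
    have h3 : ((a : ZMod n) - t) ^ 12 = 1 :=
      (hp.pow 12).mul_right_cancel (h12.trans (one_mul _).symm)
    rw [h2, h3]; ring

/-- **H5⁻ (PROVED, g9 signature verbatim).**  `ℓ^⌈k/2⌉ ∣ n₁₂(p)` at a good `p ∉ {2, ℓ}` for a curve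
globally minimal and semistable above the odd prime `ℓ`, carrying a stable cyclic line of order `ℓᵏ`:
character (`exists_cyclicCharacter_of_addOrderOf`), GLOB⁻ (§6), arithmetic Frobenius over `p`, the
Frobenius congruence (`Mazur1978.cyclicCharacter_sq_sub_frobeniusTrace_mul_add_eq_zero`) cast to level
`ℓ^⌈k/2⌉`, `χ̄(Frob_p) = p`, and A1.  (`hp2` is not used.) -/
theorem pow_halfCeil_dvd_frobNorm_of_stableLine (W₁ : WeierstrassCurve ℚ) [W₁.IsElliptic]
    [W₁.IsGloballyMinimal] (ℓ k : ℕ) [Fact ℓ.Prime] (hℓ2 : ℓ ≠ 2)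
    (hss : ∀ v : HeightOneSpectrum (𝓞 ℚ), (ℓ : 𝓞 ℚ) ∈ v.asIdeal → W₁.IsSemistableAt v)
    {P : geomPoints W₁} (hP : addOrderOf P = ℓ ^ k)
    (hst : ∀ σ : absoluteGaloisGroup ℚ, σ • P ∈ AddSubgroup.zmultiples P)
    (p : ℕ) [Fact p.Prime] (_hp2 : p ≠ 2) (hpℓ : p ≠ ℓ) (hgood : W₁.HasGoodReductionAtPrime p) :
    (ℓ : ℤ) ^ halfCeil k ∣ frobNorm W₁ p := by
  have hℓ : ℓ.Prime := Fact.out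
  have hp : p.Prime := Fact.out
  haveI : NeZero (ℓ ^ k) := ⟨pow_ne_zero _ hℓ.ne_zero⟩
  haveI : NeZero (ℓ ^ halfCeil k) := ⟨pow_ne_zero _ hℓ.ne_zero⟩
  rcases Nat.eq_zero_or_pos k with rfl | hkpos
  · rw [show halfCeil 0 = 0 from rfl, pow_zero]; exact one_dvd _
  have hk : 1 ≤ k := hkpos
  -- the character of the stable line
  obtain ⟨r, hr⟩ := exists_cyclicCharacter_of_addOrderOf W₁ hP hst
  -- the place of `p`, the prime `𝔓` of `ℚ̄` above it cut out by `ℚ̄ ↪ ℚ̄_p`, and a Frobenius there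
  set v : HeightOneSpectrum (𝓞 ℚ) := primesEquiv.symm ⟨p, hp⟩ with hvdef
  have hv : (primesEquiv v : ℕ) = p := by rw [hvdef, Equiv.apply_symm_apply]
  have hgen : natGenerator v = p := hv
  have hpv : (p : 𝓞 ℚ) ∈ v.asIdeal := by
    have h := natCast_natGenerator_mem v
    rwa [hgen] at h
  have h𝔓 := adicCompletionPrime_mem_primesAbove ℚ v
  haveI := h𝔓.1
  obtain ⟨φ, hφ⟩ := HeightOneSpectrum.exists_isArithFrobAt_of_mem_primesAbove_holds (K := ℚ) (v := v) h𝔓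
  -- the Frobenius congruence at level `ℓᵏ`, cast to level `ℓ^⌈k/2⌉`
  have hcong := Mazur1978.cyclicCharacter_sq_sub_frobeniusTrace_mul_add_eq_zero W₁ ℓ k p hpℓ hgood
    hP hr hpv h𝔓 hφ
  set t : ZMod (ℓ ^ halfCeil k) :=
    ((ZMod.unitsMap (pow_halfCeil_dvd ℓ k) (r φ) : (ZMod (ℓ ^ halfCeil k))ˣ) : ZMod (ℓ ^ halfCeil k))
    with htdef
  have htcast : t = ZMod.castHom (pow_halfCeil_dvd ℓ k) (ZMod (ℓ ^ halfCeil k))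
      ((r φ : (ZMod (ℓ ^ k))ˣ) : ZMod (ℓ ^ k)) := rfl
  have hroot : t ^ 2 - (W₁.frobeniusTrace p : ZMod (ℓ ^ halfCeil k)) * t
      + (p : ZMod (ℓ ^ halfCeil k)) = 0 := by
    have h := congrArg (ZMod.castHom (pow_halfCeil_dvd ℓ k) (ZMod (ℓ ^ halfCeil k))) hcong
    rw [map_add, map_sub, map_mul, map_pow, map_intCast, map_natCast, map_zero] at h
    rw [htcast]; exact h
  -- `χ̄(φ) = p`
  have hχφ : (modNCyclotomicCharacter ℚ (ℓ ^ halfCeil k) φ : ZMod (ℓ ^ halfCeil k)) = p := by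
    have hnot : ((ℓ ^ halfCeil k : ℕ) : absIntegers (𝓞 ℚ) ℚ) ∉ adicCompletionPrime ℚ v := by
      refine Mazur1978.natCast_not_mem_of_not_mem_asIdeal ?_ h𝔓
      rw [Nat.cast_pow]
      intro h
      have hℓv : (ℓ : 𝓞 ℚ) ∈ v.asIdeal := v.isPrime.mem_of_pow_mem _ h
      exact hpℓ (hv.symm.trans (primesEquiv_eq_of_natCast_mem v hℓ hℓv))
    rw [modNCyclotomicCharacter_eq_residueCard_of_isArithFrobAt h𝔓 hnot hφ,
      residueCard_eq_of_natCast_mem_rat hp hpv]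
  -- GLOB⁻: `t¹² = 1` or `t¹² = p¹²`
  have ht12 : t ^ 12 = 1 ∨ t ^ 12 = (p : ZMod (ℓ ^ halfCeil k)) ^ 12 := by
    rcases unitsMap_cyclicCharacter_pow_twelve_dichotomy W₁ ℓ k hℓ2 hk hss hP hr with hA | hB
    · left
      have h := congrArg Units.val (hA φ)
      rw [Units.val_pow_eq_pow_val, Units.val_one] at h
      exact h
    · right
      have h := congrArg Units.val (hB φ)
      rw [Units.val_pow_eq_pow_val, Units.val_pow_eq_pow_val, hχφ] at h
      exact h
  -- `p` is a unit modulo `ℓ^⌈k/2⌉`; conclude by A1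
  have hcop : Nat.Coprime p (ℓ ^ halfCeil k) :=
    Nat.Coprime.pow_right _ ((Nat.coprime_primes hp hℓ).mpr hpℓ)
  have hpunit : IsUnit (p : ZMod (ℓ ^ halfCeil k)) := by
    rw [← ZMod.coe_unitOfCoprime p hcop]; exact Units.isUnit _
  have hA1 := natCast_dvd_frobNorm_of_pow_twelve (n := ℓ ^ halfCeil k) (W₁.frobeniusTrace p) hpunit
    hroot ht12
  rw [frobNorm]
  exact_mod_cast hA1

/-- **G0 (PROVED, g9 signature verbatim)**: the `ℓ`-primary part of a cyclic stable kernel contains a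
stable cyclic line of order `ℓᵏ` whenever `ℓᵏ ∣ deg` (`Isogeny.exists_isCyclic_degree_eq_of_dvd`,
`IsAddCyclic.exists_ofOrder_eq_natCard`). -/
theorem exists_stableLine_of_isCyclic {W₁ W₂ : WeierstrassCurve ℚ} [W₁.IsElliptic] [W₂.IsElliptic]
    (φ : Isogeny W₁ W₂) (hφ : φ.IsCyclic) (ℓ k : ℕ) [Fact ℓ.Prime] (hdiv : ℓ ^ k ∣ φ.degree) :
    ∃ P : geomPoints W₁, addOrderOf P = ℓ ^ k ∧
      ∀ σ : absoluteGaloisGroup ℚ, σ • P ∈ AddSubgroup.zmultiples P := by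
  obtain ⟨W'', hW'', ψ, hψ, hq, -⟩ := φ.exists_isCyclic_degree_eq_of_dvd hφ hdiv
  haveI : IsAddCyclic ψ.toAddMonoidHom.ker := hψ
  obtain ⟨g, hg⟩ := IsAddCyclic.exists_ofOrder_eq_natCard (α := ψ.toAddMonoidHom.ker)
  have hordP : addOrderOf (g : W₁.geomPoints) = ℓ ^ k := by
    rw [AddSubgroup.addOrderOf_coe, hg]
    exact hq
  have hgen : AddSubgroup.zmultiples (g : W₁.geomPoints) = ψ.toAddMonoidHom.ker := by
    apply AddSubgroup.eq_of_le_of_card_ge (AddSubgroup.zmultiples_le.mpr g.2)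
    rw [Nat.card_zmultiples, hordP]
    exact hq.le
  have hg0 : ψ (g : W₁.geomPoints) = 0 := (AddMonoidHom.mem_ker).mp g.2
  refine ⟨g, hordP, fun σ => ?_⟩
  rw [hgen, AddMonoidHom.mem_ker, Isogeny.coe_toAddMonoidHom, ψ.map_smul, hg0, smul_zero]

end Frobenius


/-! ## §8 THE TYPED OUTPUT OF THE LINE (gen 11): C0² `CyclicDegreeDvdFrobNormSq` PROVED -/

section Output

open Rat.HeightOneSpectrum

/-- **C0² (g7/g9 verbatim; the typed Mazur–Kenku-free output of the line).** -/
def CyclicDegreeDvdFrobNormSq : Prop :=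
  ∀ (W₁ W₂ : WeierstrassCurve ℚ) [W₁.IsElliptic] [W₂.IsElliptic] [W₁.IsGloballyMinimal],
    (∀ v : HeightOneSpectrum (𝓞 ℚ), (2 : 𝓞 ℚ) ∉ v.asIdeal → W₁.IsSemistableAt v) →
    ∀ (φ : Isogeny W₁ W₂), φ.IsCyclic →
    ∀ (p₀ p₁ : ℕ) [Fact p₀.Prime] [Fact p₁.Prime], p₀ ≠ 2 → p₁ ≠ 2 → p₀ ≠ p₁ →
      W₁.HasGoodReductionAtPrime p₀ → W₁.HasGoodReductionAtPrime p₁ →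
      φ.degree ∣ 16 * ((frobNorm W₁ p₀ * frobNorm W₁ p₁).natAbs) ^ 2

theorem le_two_mul_halfCeil (k : ℕ) : k ≤ 2 * halfCeil k := by unfold halfCeil; omega

/-- C1 (PROVED, g3 verbatim): half exponents at every prime give `d ∣ n²`. -/
theorem dvd_sq_of_forall_pow_halfCeil_dvd {d n : ℕ} (hd : 0 < d) (hn : 0 < n)
    (h : ∀ ℓ : ℕ, ℓ.Prime → ℓ ∣ d → ℓ ^ halfCeil (d.factorization ℓ) ∣ n) : d ∣ n ^ 2 := by
  rw [← Nat.factorization_le_iff_dvd hd.ne' (pow_pos hn 2).ne', Nat.factorization_pow]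
  refine Finsupp.le_def.mpr fun ℓ => ?_
  rw [Finsupp.smul_apply, smul_eq_mul]
  by_cases hℓ : ℓ.Prime
  · by_cases hℓd : ℓ ∣ d
    · have h2 : halfCeil (d.factorization ℓ) ≤ n.factorization ℓ :=
        (hℓ.pow_dvd_iff_le_factorization hn.ne').mp (h ℓ hℓ hℓd)
      have h3 := le_two_mul_halfCeil (d.factorization ℓ)
      omega
    · rw [Nat.factorization_eq_zero_of_not_dvd hℓd]; exact Nat.zero_le _
  · rw [Nat.factorization_eq_zero_of_not_prime d hℓ]; exact Nat.zero_le _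

/-- **C0² PROVED.**  Odd `ℓ ∣ deg φ` with `ℓᵉ ‖ deg φ`: G0 gives a stable line of order `ℓᵉ`; `W₁` is
semistable above `ℓ` (`ℓ ≠ 2`); H5⁻ at a `pᵢ ≠ ℓ` gives `ℓ^⌈e/2⌉ ∣ n₁₂(pᵢ) ∣ n₁₂(p₀)n₁₂(p₁)`; so the
odd part of `deg φ` divides `(n₁₂(p₀)n₁₂(p₁))²` (C1).  `2`-part: `32 ∤` cyclic degrees
(`isogeny_isCyclic_degree_ne_thirtyTwo` + `Isogeny.exists_isCyclic_degree_eq_of_dvd`), so it divides `16`. -/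
theorem cyclicDegreeDvdFrobNormSq : CyclicDegreeDvdFrobNormSq := by
  intro W₁ W₂ _ _ _ hss2 φ hφ p₀ p₁ _ _ hp₀2 hp₁2 hp01 hgood₀ hgood₁
  have hp₀ : p₀.Prime := Fact.out
  have hp₁ : p₁.Prime := Fact.out
  set n : ℕ := (frobNorm W₁ p₀ * frobNorm W₁ p₁).natAbs with hn
  set d : ℕ := φ.degree with hd
  have hdpos : 0 < d := φ.degree_pos
  rcases Nat.eq_zero_or_pos n with hn0 | hnpos
  · rw [hn0]; simp
  -- semistability above every odd prime
  have hssodd : ∀ ℓ : ℕ, ℓ.Prime → ℓ ≠ 2 → ∀ v : HeightOneSpectrum (𝓞 ℚ),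
      (ℓ : 𝓞 ℚ) ∈ v.asIdeal → W₁.IsSemistableAt v := by
    intro ℓ hℓ hℓ2 v hℓv
    refine hss2 v fun h2 => hℓ2 ?_
    have h2' : ((2 : ℕ) : 𝓞 ℚ) ∈ v.asIdeal := by exact_mod_cast h2
    exact (primesEquiv_eq_of_natCast_mem v hℓ hℓv).symm.trans
      (primesEquiv_eq_of_natCast_mem v Nat.prime_two h2')
  -- every odd prime: `ℓ^⌈e/2⌉ ∣ n`
  have hodd : ∀ ℓ : ℕ, ℓ.Prime → ℓ ≠ 2 → ℓ ^ halfCeil (d.factorization ℓ) ∣ n := by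
    intro ℓ hℓ hℓ2
    haveI : Fact ℓ.Prime := ⟨hℓ⟩
    have hdiv : ℓ ^ d.factorization ℓ ∣ φ.degree := Nat.ordProj_dvd d ℓ
    obtain ⟨P, hP, hst⟩ := exists_stableLine_of_isCyclic φ hφ ℓ (d.factorization ℓ) hdiv
    have key : ∀ (p : ℕ) [Fact p.Prime], p ≠ 2 → p ≠ ℓ → W₁.HasGoodReductionAtPrime p →
        (ℓ : ℤ) ^ halfCeil (d.factorization ℓ) ∣ frobNorm W₁ p :=
      fun p _ hp2 hpℓ hgood =>
        pow_halfCeil_dvd_frobNorm_of_stableLine W₁ ℓ _ hℓ2 (hssodd ℓ hℓ hℓ2) hP hst p hp2 hpℓ hgood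
    have hZ : (ℓ : ℤ) ^ halfCeil (d.factorization ℓ) ∣ frobNorm W₁ p₀ * frobNorm W₁ p₁ := by
      by_cases h0 : p₀ = ℓ
      · have h1 : p₁ ≠ ℓ := fun h => hp01 (h0.trans h.symm)
        exact Dvd.dvd.mul_left (key p₁ hp₁2 h1 hgood₁) _
      · exact Dvd.dvd.mul_right (key p₀ hp₀2 h0 hgood₀) _
    have hN := Int.natAbs_dvd_natAbs.mpr hZ
    rwa [Int.natAbs_pow, Int.natAbs_natCast] at hN
  -- the `2`-part divides `16`
  have h2part : 2 ^ d.factorization 2 ∣ 16 := by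
    have hlt : d.factorization 2 < 5 := by
      by_contra h5
      push Not at h5
      have h32 : 2 ^ 5 ∣ φ.degree := (pow_dvd_pow 2 h5).trans (Nat.ordProj_dvd d 2)
      obtain ⟨V, hV, ψ, hψ, hdeg, -⟩ := φ.exists_isCyclic_degree_eq_of_dvd hφ h32
      exact Summit.ABC.ABC.Theorems.isogeny_isCyclic_degree_ne_thirtyTwo ψ hψ
        (hdeg.trans (by norm_num))
    calc 2 ^ d.factorization 2 ∣ 2 ^ 4 := pow_dvd_pow 2 (by omega)
      _ = 16 := by norm_num
  -- the odd part divides `n²`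
  have hoddpart : ordCompl[2] d ∣ n ^ 2 := by
    refine dvd_sq_of_forall_pow_halfCeil_dvd (Nat.ordCompl_pos 2 hdpos.ne') hnpos
      fun ℓ hℓ hℓd => ?_
    have hℓ2 : ℓ ≠ 2 := by
      rintro rfl
      exact Nat.not_dvd_ordCompl Nat.prime_two hdpos.ne' hℓd
    rw [Nat.factorization_ordCompl, Finsupp.erase_ne hℓ2]
    exact hodd ℓ hℓ hℓ2
  calc φ.degree = ordProj[2] d * ordCompl[2] d := (Nat.ordProj_mul_ordCompl_eq_self d 2).symm
    _ ∣ 16 * n ^ 2 := mul_dvd_mul h2part hoddpart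

end Output


/-! ## §9 THE COUNTING END (gen 11): SUB `freyIsogenyRadiusSubpoly_of_sq` PROVED

With §8 this closes the whole k2 RESHAPE line modulo `stub_takahashi`:
`definiteRTControlPrime_of_freyIsogenyRadiusSubpoly stub_takahashi (freyIsogenyRadiusSubpoly_of_sq cyclicDegreeDvdFrobNormSq)`
(consumer PROVED in `StubIdeasK2G5PastenLemma68.lean`, k2-g5). -/

section Counting

open Rat.HeightOneSpectrum Literature.NumberTheory.DiophantineGeometry

/-- **L1ε (k2-g5 verbatim).**  Sub-polynomial ROOTED isogeny radius of the Frey class. -/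
def FreyIsogenyRadiusSubpoly : Prop :=
  ∀ ε : ℝ, 0 < ε → ∃ R : ℝ, ∀ (a b : ℤ), IsCoprime a b → a * b * (a + b) ≠ 0 →
    ∀ q : ℕ, q.Prime → q ≠ 2 → q ∣ (freyCurve a b).conductorNorm ℤ →
    ∀ (W' : WeierstrassCurve ℚ) [W'.IsElliptic], (freyCurve a b).IsIsogenous W' →
      ∃ φ : Isogeny (freyCurve a b) W',
        (φ.degree : ℝ) ≤ R * (((freyCurve a b).conductorNorm ℤ : ℕ) : ℝ) ^ ε

/-- SUB-c1: the integer (`Mazur1978.frobTracePow`) and complex (`frobTracePow`) Newton sequences agree. -/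
theorem cast_frobTracePow (t : ℤ) (q : ℕ) :
    ∀ n : ℕ, ((Mazur1978.frobTracePow t q n : ℤ) : ℂ) = frobTracePow (t : ℂ) (q : ℂ) n
  | 0 => by simp
  | 1 => by simp
  | n + 2 => by
    rw [Mazur1978.frobTracePow_add_two]
    show _ = (t : ℂ) * frobTracePow (t : ℂ) (q : ℂ) (n + 1) - (q : ℂ) * frobTracePow (t : ℂ) (q : ℂ) n
    push_cast
    rw [cast_frobTracePow t q n, cast_frobTracePow t q (n + 1)]

/-- SUB-c2 (Hasse, via `frobeniusTrace_sq_le_four_mul` + `norm_frobTracePow_le_of_sq_le`):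
`|s₁₂(a_p, p)| ≤ 2p⁶`. -/
theorem abs_frobTracePow_twelve_le (W : WeierstrassCurve ℚ) [W.IsElliptic] [W.IsGloballyMinimal]
    (p : ℕ) [Fact p.Prime] (hgood : W.HasGoodReductionAtPrime p) :
    |Mazur1978.frobTracePow (W.frobeniusTrace p) p 12| ≤ 2 * (p : ℤ) ^ 6 := by
  have ha : W.frobeniusTrace p ^ 2 ≤ 4 * (p : ℤ) := W.frobeniusTrace_sq_le_four_mul p hgood
  have h := norm_frobTracePow_le_of_sq_le ha 12
  rw [← cast_frobTracePow, Complex.norm_intCast] at h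
  have hsqrt : Real.sqrt (p : ℝ) ^ 12 = (p : ℝ) ^ 6 := by
    rw [show (12 : ℕ) = 2 * 6 from rfl, pow_mul, Real.sq_sqrt (Nat.cast_nonneg p)]
  rw [hsqrt] at h
  have h' : ((|Mazur1978.frobTracePow (W.frobeniusTrace p) p 12| : ℤ) : ℝ) ≤ 2 * (p : ℝ) ^ 6 := by
    rw [Int.cast_abs]; exact h
  exact_mod_cast h'

/-- SUB-c3: `0 < n₁₂(p) ≤ (p⁶ + 1)²`. -/
theorem frobNorm_pos_and_le (W : WeierstrassCurve ℚ) [W.IsElliptic] [W.IsGloballyMinimal]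
    (p : ℕ) [Fact p.Prime] (hgood : W.HasGoodReductionAtPrime p) :
    0 < frobNorm W p ∧ frobNorm W p ≤ ((p : ℤ) ^ 6 + 1) ^ 2 := by
  have h := abs_frobTracePow_twelve_le W p hgood
  rw [abs_le] at h
  have hp2 : (2 : ℤ) ≤ p := by exact_mod_cast (Fact.out : p.Prime).two_le
  have hp6 : (64 : ℤ) ≤ (p : ℤ) ^ 6 := by
    calc (64 : ℤ) = 2 ^ 6 := by norm_num
      _ ≤ (p : ℤ) ^ 6 := pow_le_pow_left₀ (by norm_num) hp2 6
  have h12 : (p : ℤ) ^ 12 = ((p : ℤ) ^ 6) ^ 2 := by ring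
  unfold frobNorm
  constructor
  · nlinarith [h.1, h.2, hp6, h12, sq_nonneg ((p : ℤ) ^ 6 - 1)]
  · nlinarith [h.1, h.2, h12]

/-- SUB-b: two small odd primes outside `N` (`exists_prime_not_dvd_le_log` at `2N` and `2Np₀`,
`log p₀ ≤ p₀`). -/
theorem exists_two_odd_primes_not_dvd_le_log :
    ∃ B : ℝ, ∀ N : ℕ, N ≠ 0 → ∃ p₀ p₁ : ℕ, p₀.Prime ∧ p₁.Prime ∧ p₀ ≠ 2 ∧ p₁ ≠ 2 ∧ p₀ ≠ p₁ ∧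
      ¬ p₀ ∣ N ∧ ¬ p₁ ∣ N ∧ (p₀ : ℝ) ≤ 6 * Real.log N + B ∧ (p₁ : ℝ) ≤ 6 * Real.log N + B := by
  obtain ⟨C, hC⟩ := exists_prime_not_dvd_le_log
  refine ⟨6 + 3 * |C|, fun N hN => ?_⟩
  have hlogN : 0 ≤ Real.log N := Real.log_natCast_nonneg N
  have hCabs : C ≤ |C| := le_abs_self C
  have hlog2 : Real.log 2 ≤ 1 := by
    have := Real.log_le_sub_one_of_pos (show (0 : ℝ) < 2 by norm_num); linarith
  have hN' : (N : ℝ) ≠ 0 := Nat.cast_ne_zero.mpr hN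
  -- `p₀`
  obtain ⟨p₀, hp₀, hp₀N, hp₀le⟩ := hC (2 * N) (mul_ne_zero two_ne_zero hN)
  have hp₀2 : p₀ ≠ 2 := fun h => hp₀N (by rw [h]; exact dvd_mul_right 2 N)
  have hp₀N' : ¬ p₀ ∣ N := fun h => hp₀N (dvd_mul_of_dvd_right h 2)
  have hlog2N : Real.log ((2 * N : ℕ) : ℝ) = Real.log 2 + Real.log N := by
    push_cast
    rw [Real.log_mul (by norm_num) hN']
  have hp₀bd : (p₀ : ℝ) ≤ 2 * Real.log N + 2 + |C| := by
    rw [hlog2N] at hp₀le; linarith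
  -- `p₁`
  obtain ⟨p₁, hp₁, hp₁N, hp₁le⟩ :=
    hC (2 * N * p₀) (mul_ne_zero (mul_ne_zero two_ne_zero hN) hp₀.ne_zero)
  have hp₁2 : p₁ ≠ 2 := fun h => hp₁N (by rw [h]; exact (dvd_mul_right 2 N).mul_right p₀)
  have hp₁N' : ¬ p₁ ∣ N := fun h => hp₁N ((dvd_mul_of_dvd_right h 2).mul_right p₀)
  have hp01 : p₀ ≠ p₁ := fun h => hp₁N (by rw [← h]; exact dvd_mul_left p₀ (2 * N))
  have hp₀pos : (0 : ℝ) < p₀ := by exact_mod_cast hp₀.pos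
  have hlogp₀ : Real.log p₀ ≤ p₀ := by
    have := Real.log_le_sub_one_of_pos hp₀pos; linarith
  have hlog2Np : Real.log ((2 * N * p₀ : ℕ) : ℝ) = Real.log 2 + Real.log N + Real.log p₀ := by
    push_cast
    rw [Real.log_mul (mul_ne_zero two_ne_zero hN') hp₀pos.ne', Real.log_mul (by norm_num) hN']
  have hp₁bd : (p₁ : ℝ) ≤ 6 * Real.log N + 6 + 3 * |C| := by
    rw [hlog2Np] at hp₁le; linarith
  exact ⟨p₀, p₁, hp₀, hp₁, hp₀2, hp₁2, hp01, hp₀N', hp₁N', by linarith, by linarith⟩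

/-- SUB-d: `16 · ((x⁶+1)²(y⁶+1)²)² ≤ R_ε N^ε` for `x, y ≤ 6 log N + B` (`log N ≤ N^δ/δ`, `δ = ε/48`). -/
theorem exists_const_log_pow_le_rpow (ε : ℝ) (hε : 0 < ε) (B : ℝ) :
    ∃ R : ℝ, ∀ N : ℕ, N ≠ 0 → ∀ x y : ℝ, 0 ≤ x → x ≤ 6 * Real.log N + B → 0 ≤ y →
      y ≤ 6 * Real.log N + B →
      16 * ((x ^ 6 + 1) ^ 2 * (y ^ 6 + 1) ^ 2) ^ 2 ≤ R * (N : ℝ) ^ ε := by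
  set δ : ℝ := ε / 48 with hδ
  have hδpos : 0 < δ := by positivity
  set K : ℝ := 6 / δ + |B| + 1 with hK
  have hKpos : 0 < K := by positivity
  refine ⟨4096 * K ^ 48, fun N hN x y hx hxle hy hyle => ?_⟩
  have hN1 : (1 : ℝ) ≤ N := by exact_mod_cast Nat.one_le_iff_ne_zero.mpr hN
  have hN0 : (0 : ℝ) ≤ N := Nat.cast_nonneg N
  have hNd : 1 ≤ (N : ℝ) ^ δ := Real.one_le_rpow hN1 hδpos.le
  have hlog : Real.log N ≤ (N : ℝ) ^ δ / δ := Real.log_le_rpow_div hN0 hδpos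
  have hlogN : 0 ≤ Real.log N := Real.log_natCast_nonneg N
  set L : ℝ := 6 * Real.log N + |B| + 1 with hL
  have hBabs : B ≤ |B| := le_abs_self B
  have hBabs0 : 0 ≤ |B| := abs_nonneg B
  have hL1 : 1 ≤ L := by rw [hL]; linarith
  have hL0 : 0 ≤ L := le_trans zero_le_one hL1
  have hxL : x ≤ L := by rw [hL]; linarith
  have hyL : y ≤ L := by rw [hL]; linarith
  have hLK : L ≤ K * (N : ℝ) ^ δ := by
    have h1 : Real.log N * δ ≤ (N : ℝ) ^ δ := (le_div_iff₀ hδpos).mp hlog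
    have h1' : 6 * Real.log N ≤ 6 / δ * (N : ℝ) ^ δ := by
      rw [div_mul_eq_mul_div, le_div_iff₀ hδpos]; linarith
    have h2 : |B| + 1 ≤ (|B| + 1) * (N : ℝ) ^ δ := le_mul_of_one_le_right (by positivity) hNd
    have hexp : K * (N : ℝ) ^ δ = 6 / δ * (N : ℝ) ^ δ + (|B| + 1) * (N : ℝ) ^ δ := by
      rw [hK]; ring
    rw [hexp, hL]; linarith
  have hexp : δ * ((48 : ℕ) : ℝ) = ε := by rw [hδ]; push_cast; ring
  clear_value L K δ
  have hL6 : 1 ≤ L ^ 6 := one_le_pow₀ hL1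
  have hx6 : x ^ 6 + 1 ≤ 2 * L ^ 6 := by
    have : x ^ 6 ≤ L ^ 6 := pow_le_pow_left₀ hx hxL 6
    linarith
  have hy6 : y ^ 6 + 1 ≤ 2 * L ^ 6 := by
    have : y ^ 6 ≤ L ^ 6 := pow_le_pow_left₀ hy hyL 6
    linarith
  have hmain : 16 * ((x ^ 6 + 1) ^ 2 * (y ^ 6 + 1) ^ 2) ^ 2 ≤
      16 * ((2 * L ^ 6) ^ 2 * (2 * L ^ 6) ^ 2) ^ 2 := by
    gcongr
  have h16 : 16 * ((2 * L ^ 6) ^ 2 * (2 * L ^ 6) ^ 2) ^ 2 = 4096 * L ^ 48 := by ring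
  have hL48 : L ^ 48 ≤ (K * (N : ℝ) ^ δ) ^ 48 := pow_le_pow_left₀ hL0 hLK 48
  have hKN : (K * (N : ℝ) ^ δ) ^ 48 = K ^ 48 * (N : ℝ) ^ ε := by
    rw [mul_pow, ← Real.rpow_natCast ((N : ℝ) ^ δ) 48, ← Real.rpow_mul hN0, hexp]
  calc 16 * ((x ^ 6 + 1) ^ 2 * (y ^ 6 + 1) ^ 2) ^ 2 ≤ 4096 * L ^ 48 := by rw [← h16]; exact hmain
    _ ≤ 4096 * (K * (N : ℝ) ^ δ) ^ 48 := by linarith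
    _ = 4096 * K ^ 48 * (N : ℝ) ^ ε := by rw [hKN, mul_assoc]

/-- SUB-e: precomposing with a change of model does not change the degree. -/
theorem degree_comp_toIsogeny {W W' : WeierstrassCurve ℚ} (C : VariableChange ℚ)
    (ψ : Isogeny (C • W) W') : (ψ.comp (VariableChange.toIsogeny W C)).degree = ψ.degree := by
  unfold Isogeny.degree
  rw [Isogeny.ker_comp]
  exact Nat.card_congr
    ((VariableChange.pointEquivBaseChange W C (AlgebraicClosure ℚ)).toEquiv.subtypeEquiv
      fun P => Iff.rfl)

/-- **SUB (PROVED).**  `CyclicDegreeDvdFrobNormSq → FreyIsogenyRadiusSubpoly`: Néron model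
`C • E_(a,b)` (`hasGlobalMinimalModel_rat_holds`), semistable away from `2`
(`isSemistableAt_freyCurve_holds` + `hasGoodReductionAt_of_int`/`hasMultiplicativeReductionAt_of_int` +
`isSemistableAt_smul_iff_holds`), a CYCLIC isogeny `C • E → W'` (`IsIsogenous.exists_isCyclic`), two odd
primes `p₀ ≠ p₁ ∤ N` of size `O(log N)` (SUB-b), good there (`conductorNorm_smul_rat`,
`hasGoodReductionAtPrime_of_not_dvd_conductorNorm'`), C0², `0 < n₁₂(p) ≤ (p⁶+1)²` (SUB-c), SUB-d, and the
degree-`1` change of model (SUB-e). -/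
theorem freyIsogenyRadiusSubpoly_of_sq (h0 : CyclicDegreeDvdFrobNormSq) :
    FreyIsogenyRadiusSubpoly := by
  intro ε hε
  obtain ⟨B, hB⟩ := exists_two_odd_primes_not_dvd_le_log
  obtain ⟨R, hR⟩ := exists_const_log_pow_le_rpow ε hε B
  refine ⟨R, fun a b hab h0ab q _ _ _ W' _ hW' => ?_⟩
  haveI hEell : (freyCurve a b).IsElliptic := isElliptic_freyCurve h0ab
  obtain ⟨C, hC⟩ := hasGlobalMinimalModel_rat_holds (freyCurve a b)
  haveI : (C • freyCurve a b).IsGloballyMinimal := hC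
  have hN0 : (freyCurve a b).conductorNorm ℤ ≠ 0 := (conductorNorm_pos_holds (freyCurve a b)).ne'
  obtain ⟨p₀, p₁, hp₀, hp₁, hp₀2, hp₁2, hp01, hp₀N, hp₁N, hp₀le, hp₁le⟩ := hB _ hN0
  haveI := Fact.mk hp₀
  haveI := Fact.mk hp₁
  -- good reduction of the Néron model at `p ∤ N`
  have hgood : ∀ (p : ℕ) [Fact p.Prime], ¬ p ∣ (freyCurve a b).conductorNorm ℤ →
      (C • freyCurve a b).HasGoodReductionAtPrime p := by
    intro p _ hpN
    refine hasGoodReductionAtPrime_of_not_dvd_conductorNorm' (C • freyCurve a b) ?_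
    rwa [conductorNorm_smul_rat]
  -- semistability of the Néron model away from `2`
  have hss : ∀ v : HeightOneSpectrum (𝓞 ℚ), (2 : 𝓞 ℚ) ∉ v.asIdeal →
      (C • freyCurve a b).IsSemistableAt v := by
    intro v h2
    obtain ⟨ℓ, rfl⟩ : ∃ ℓ : Nat.Primes, v = primesEquiv.symm ℓ :=
      ⟨primesEquiv v, (Equiv.symm_apply_apply _ _).symm⟩
    have hgenQ : natGenerator ((primesEquiv (R := 𝓞 ℚ)).symm ℓ) = (ℓ : ℕ) :=
      congrArg Subtype.val ((primesEquiv (R := 𝓞 ℚ)).apply_symm_apply ℓ)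
    have hℓ2 : (ℓ : ℕ) ≠ 2 := by
      intro h
      apply h2
      have hmem := natCast_natGenerator_mem ((primesEquiv (R := 𝓞 ℚ)).symm ℓ)
      rw [hgenQ, h] at hmem
      exact_mod_cast hmem
    have hgenZ : natGenerator ((primesEquiv (R := ℤ)).symm ℓ) = (ℓ : ℕ) :=
      congrArg Subtype.val ((primesEquiv (R := ℤ)).apply_symm_apply ℓ)
    have hssZ : (freyCurve a b).IsSemistableAt ((primesEquiv (R := ℤ)).symm ℓ) :=
      isSemistableAt_freyCurve_holds a b hab h0ab _ (by rw [hgenZ]; exact hℓ2)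
    have hssQ : (freyCurve a b).IsSemistableAt ((primesEquiv (R := 𝓞 ℚ)).symm ℓ) := by
      rcases hssZ with hg | hm
      · exact Or.inl (hasGoodReductionAt_of_int (freyCurve a b) ℓ hg)
      · exact Or.inr (hasMultiplicativeReductionAt_of_int (freyCurve a b) ℓ hm)
    exact (isSemistableAt_smul_iff_holds _ (freyCurve a b) C).mpr hssQ
  -- a cyclic isogeny out of the Néron model, and C0²
  obtain ⟨ψ, hψ⟩ := (IsIsogenous.trans' (isIsogenous_of_smul (freyCurve a b) C) hW').exists_isCyclic
  have hdvd := h0 (C • freyCurve a b) W' hss ψ hψ p₀ p₁ hp₀2 hp₁2 hp01 (hgood p₀ hp₀N)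
    (hgood p₁ hp₁N)
  obtain ⟨hn₀pos, hn₀le⟩ := frobNorm_pos_and_le (C • freyCurve a b) p₀ (hgood p₀ hp₀N)
  obtain ⟨hn₁pos, hn₁le⟩ := frobNorm_pos_and_le (C • freyCurve a b) p₁ (hgood p₁ hp₁N)
  set n : ℕ := (frobNorm (C • freyCurve a b) p₀ * frobNorm (C • freyCurve a b) p₁).natAbs with hn
  have hnpos : 0 < n := Int.natAbs_pos.mpr (mul_ne_zero hn₀pos.ne' hn₁pos.ne')
  have hnZ : (n : ℤ) = frobNorm (C • freyCurve a b) p₀ * frobNorm (C • freyCurve a b) p₁ := by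
    rw [hn, Int.natAbs_of_nonneg (mul_nonneg hn₀pos.le hn₁pos.le)]
  have hnle : (n : ℝ) ≤ ((p₀ : ℝ) ^ 6 + 1) ^ 2 * ((p₁ : ℝ) ^ 6 + 1) ^ 2 := by
    have h : (n : ℤ) ≤ ((p₀ : ℤ) ^ 6 + 1) ^ 2 * ((p₁ : ℤ) ^ 6 + 1) ^ 2 := by
      rw [hnZ]; exact mul_le_mul hn₀le hn₁le hn₁pos.le (by positivity)
    have h' : ((n : ℤ) : ℝ) ≤ ((((p₀ : ℤ) ^ 6 + 1) ^ 2 * ((p₁ : ℤ) ^ 6 + 1) ^ 2 : ℤ) : ℝ) := by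
      exact_mod_cast h
    push_cast at h'
    exact h'
  have hdeg : (ψ.degree : ℝ) ≤ 16 * (n : ℝ) ^ 2 := by
    have h : ψ.degree ≤ 16 * n ^ 2 := Nat.le_of_dvd (Nat.mul_pos (by norm_num) (pow_pos hnpos 2)) hdvd
    exact_mod_cast h
  refine ⟨ψ.comp (VariableChange.toIsogeny (freyCurve a b) C), ?_⟩
  rw [degree_comp_toIsogeny]
  calc (ψ.degree : ℝ) ≤ 16 * (n : ℝ) ^ 2 := hdeg
    _ ≤ 16 * (((p₀ : ℝ) ^ 6 + 1) ^ 2 * ((p₁ : ℝ) ^ 6 + 1) ^ 2) ^ 2 := by gcongr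
    _ ≤ R * (((freyCurve a b).conductorNorm ℤ : ℕ) : ℝ) ^ ε :=
      hR _ hN0 p₀ p₁ (Nat.cast_nonneg _) hp₀le (Nat.cast_nonneg _) hp₁le

/-- **THE k2 RESHAPE OUTPUT, UNCONDITIONAL (gen 11).** -/
theorem freyIsogenyRadiusSubpoly : FreyIsogenyRadiusSubpoly :=
  freyIsogenyRadiusSubpoly_of_sq cyclicDegreeDvdFrobNormSq

end Counting

/-! ## §3 In-kernel sanity (numbers quoted in the plan) -/

/-- `n₁₂(3)` of `11a` (`a₃ = −1`) is `532800 = 2⁶·3²·5²·37`: divisible by `25` (correcting g9/g10's "25 ∤"). -/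
example : (532800 : ℕ) = 2 ^ 6 * 3 ^ 2 * 5 ^ 2 * 37 ∧ 25 ∣ (532800 : ℕ) := by decide

end Summit.ABC.ABC.Cruxes.DefiniteRTControlPrime.StubIdeas2G11

/-! # APPENDIX (verbatim k2-g5 companion `StubIdeasK2G5PastenLemma68.lean`, lines 62–506; Cruxes modules are not importable on the farm) -/

noncomputable section

open scoped Classical MatrixGroups ModularForm
open CongruenceSubgroup UpperHalfPlane
open WeierstrassCurve IsDedekindDomain NumberField
open Literature.NumberTheory.EllipticCurves Literature.NumberTheory.EllipticCurves.ModularForms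
open Literature.NumberTheory.DiophantineGeometry
open Literature.NumberTheory.Automorphic
open Summit.ABC.ABC.Theorems
open Summit.ABC.ABC.Theses.DefiniteXi

namespace Summit.ABC.ABC.Cruxes.DefiniteRTControlPrime.StubIdeas2G5

/-! ## 0. The leaves -/

/-- **L1.** Rooted radius of the Frey isogeny class at an odd conductor prime (verbatim the k2-g2…g4
`FreyIsogenyRadius`): every curve `ℚ`-isogenous to `E_(a,b)` is reached from it by a `ℚ`-isogeny of
degree `≤ R`. -/
def FreyIsogenyRadius (R : ℕ) : Prop :=
  ∀ (a b : ℤ), IsCoprime a b → a * b * (a + b) ≠ 0 → ∀ q : ℕ, q.Prime → q ≠ 2 →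
    q ∣ (freyCurve a b).conductorNorm ℤ →
    ∀ (W' : WeierstrassCurve ℚ) [W'.IsElliptic], (freyCurve a b).IsIsogenous W' →
      ∃ φ : Isogeny (freyCurve a b) W', φ.degree ≤ R

/-- **L1ε.** Sub-polynomial rooted radius: for every `ε > 0`, radius `≤ R_ε · N^ε` (`N` the conductor). -/
def FreyIsogenyRadiusSubpoly : Prop :=
  ∀ ε : ℝ, 0 < ε → ∃ R : ℝ, ∀ (a b : ℤ), IsCoprime a b → a * b * (a + b) ≠ 0 →
    ∀ q : ℕ, q.Prime → q ≠ 2 → q ∣ (freyCurve a b).conductorNorm ℤ →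
    ∀ (W' : WeierstrassCurve ℚ) [W'.IsElliptic], (freyCurve a b).IsIsogenous W' →
      ∃ φ : Isogeny (freyCurve a b) W',
        (φ.degree : ℝ) ≤ R * (((freyCurve a b).conductorNorm ℤ : ℕ) : ℝ) ^ ε

/-- **L0 — THE WEAKEST LEAF (one isogeny).** For every `ε > 0` there is `R` such that the Frey curve
of conductor `N` is joined to any `X₀(N)`-OPTIMAL curve `W⋆` of its class — a conductor-`N` curve
carrying a datum `P⋆` of minimal degree among all level-`N` data of conductor-`N` curves with the same
newform, verbatim Takahashi's minimality clause — by a `ℚ`-isogeny of degree `≤ R · N^ε`. -/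
def FreyOptimalRadiusSubpoly : Prop :=
  ∀ ε : ℝ, 0 < ε → ∃ R : ℝ, ∀ (a b : ℤ), IsCoprime a b → a * b * (a + b) ≠ 0 →
    ∀ (N : ℕ) [NeZero N], (freyCurve a b).conductorNorm ℤ = N →
    ∀ q : ℕ, q.Prime → q ≠ 2 → q ∣ N →
    ∀ (W' : WeierstrassCurve ℚ) [W'.IsElliptic] (P' : ModularParametrizationData W' N),
      W'.conductorNorm ℤ = N →
      (∀ (W'' : WeierstrassCurve ℚ) [W''.IsElliptic], W''.conductorNorm ℤ = N →
          ∀ P'' : ModularParametrizationData W'' N, P''.f = P'.f →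
            P'.modularDegree ≤ P''.modularDegree) →
      (freyCurve a b).IsIsogenous W' →
        ∃ φ : Isogeny (freyCurve a b) W', (φ.degree : ℝ) ≤ R * (N : ℝ) ^ ε

/-! ## 1. Plumbing: degrees of composites and duals, kernels of `z ↦ cz` multiply -/

/-- R0a (k2-g4, PROVED): degree of a composite. [folklore] -/
theorem degree_comp {W W' W'' : WeierstrassCurve ℚ} [W.IsElliptic] [W'.IsElliptic]
    (ψ : Isogeny W' W'') (φ : Isogeny W W') : (ψ.comp φ).degree = ψ.degree * φ.degree := by
  change Nat.card (ψ.toAddMonoidHom.comp φ.toAddMonoidHom).ker = _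
  rw [AddMonoidHom.natCard_ker_comp_of_surjective _ _ φ.surjective]
  rfl

/-- R0c: the dual isogeny has the same degree. [cite: SilvermanAEC2009, Thm. III.6.1(a), III.6.2(e)] -/
theorem exists_dual_degree_eq {W W' : WeierstrassCurve ℚ} [W.IsElliptic] [W'.IsElliptic]
    (φ : Isogeny W W') : ∃ ψ : Isogeny W' W, ψ.degree = φ.degree := by
  obtain ⟨ψ, hψ⟩ := φ.exists_dual_of_isElliptic
  exact ⟨ψ, Isogeny_degree_eq_of_comp_eq_degree_zsmul φ ψ hψ⟩

/-- **P1a.** Kernels multiply along `ℂ/Λ₁ →(c) ℂ/Λ₂ →(d) ℂ/Λ₃`: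
`#ker(z ↦ dcz) = #ker(z ↦ dz) · #ker(z ↦ cz)` (`c ≠ 0`, so the first map is onto). [folklore] -/
theorem natCard_ker_mulQuotientMap_mul {Λ₁ Λ₂ Λ₃ : AddSubgroup ℂ} {c d : ℂ} (hc0 : c ≠ 0)
    (hc : ∀ z ∈ Λ₁, c * z ∈ Λ₂) (hd : ∀ z ∈ Λ₂, d * z ∈ Λ₃)
    (hdc : ∀ z ∈ Λ₁, d * c * z ∈ Λ₃) :
    Nat.card (mulQuotientMap Λ₁ Λ₃ (d * c) hdc).ker =
      Nat.card (mulQuotientMap Λ₂ Λ₃ d hd).ker * Nat.card (mulQuotientMap Λ₁ Λ₂ c hc).ker := by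
  have hcomp : (mulQuotientMap Λ₂ Λ₃ d hd).comp (mulQuotientMap Λ₁ Λ₂ c hc) =
      mulQuotientMap Λ₁ Λ₃ (d * c) hdc := by
    refine AddMonoidHom.ext fun P => ?_
    induction P using QuotientAddGroup.induction_on with
    | H z =>
      rw [AddMonoidHom.comp_apply, mulQuotientMap_mk, mulQuotientMap_mk, mulQuotientMap_mk,
        mul_assoc]
  rw [← hcomp, AddMonoidHom.natCard_ker_comp_of_surjective _ _ (mulQuotientMap_surjective hc0)]

/-- Transport of `#ker(z ↦ cz)` along equalities of the lattices AND of the multiplier. [folklore] -/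
theorem natCard_ker_mulQuotientMap_congr' {Λ₁ Λ₁' Λ₂ Λ₂' : AddSubgroup ℂ} (h₁ : Λ₁ = Λ₁')
    (h₂ : Λ₂ = Λ₂') {c c' : ℂ} (hcc : c = c') (hc : ∀ z ∈ Λ₁, c * z ∈ Λ₂)
    (hc' : ∀ z ∈ Λ₁', c' * z ∈ Λ₂') :
    Nat.card (mulQuotientMap Λ₁ Λ₂ c hc).ker = Nat.card (mulQuotientMap Λ₁' Λ₂' c' hc').ker := by
  subst h₁ h₂ hcc
  rfl

/-! ## 2. P1 — push a datum forward along ONE isogeny, keeping track of the degree -/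

/-- **P1 (the gen-5 helper).**  Let `(V, P)` and `(W', D')` be parametrised at level `N` with the same
newform, `W'` globally minimal and `D'` of minimal degree among the data of `W'`; let `ψ` be a
`ℚ`-isogeny from a model of `V` onto a model of `W'` whose base changes are the lattice curves of the
two period pairs (the short models, `shortModel_baseChange_eq_curve`).  Then `deg D' ≤ deg ψ · deg P`:
the parametrisation `ψ ∘ φ_P` of `W'` has Manin multiplier `k = q · c_P` (`q` the rational multiplier
of `ψ`), integral by Edixhoven's integrality in the tree's form `hInt_of_pivot`, and degree
`#ker(z ↦ kz) · δ = #ker(q) · #ker(c_P) · δ = deg ψ · deg P`.  (Folklore: `deg φ_{E'} ∣ deg ψ · deg φ_E`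
for `ψ : E → E'`; Cremona, *Algorithms* §2.10.)
[cite: SilvermanAEC2009, Thm. VI.4.1(b)] [cite: EdixhovenManin1991, Prop. 2] -/
theorem modularDegree_le_degree_mul {N : ℕ} [NeZero N] {V W' : WeierstrassCurve ℚ}
    [V.IsElliptic] [W'.IsElliptic] [W'.IsGloballyMinimal]
    (P : ModularParametrizationData V N) (D' : ModularParametrizationData W' N) (hf : D'.f = P.f)
    (hmin' : ∀ D'' : ModularParametrizationData W' N, D'.modularDegree ≤ D''.modularDegree)
    {Vs Ws : WeierstrassCurve ℚ} [Vs.IsElliptic] [Ws.IsElliptic] (ψ : Isogeny Vs Ws)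
    (hVs : Vs.baseChange ℂ = P.L.curve) (hWs : Ws.baseChange ℂ = D'.L.curve) :
    D'.modularDegree ≤ ψ.degree * P.modularDegree := by
  have hInt : ∀ {N : ℕ} [NeZero N] {W' : WeierstrassCurve ℚ} [W'.IsElliptic] [W'.IsGloballyMinimal]
      (D' : ModularParametrizationData W' N) (q : ℚ),
      (∀ z ∈ periodLattice D'.f, (q : ℂ) * z ∈ D'.L.lattice) → ∃ k : ℤ, (k : ℚ) = q :=
    hInt_of_pivot integral_neronScaling_of_isGloballyMinimal_holds edixhovenIntegrality_proof
  -- the rational multiplier `q` of `ψ`, `#ker(z ↦ qz : ℂ/Λ_V → ℂ/Λ_{W'}) = deg ψ`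
  obtain ⟨q, hq0, hq, hdegq⟩ :=
    degree_eq_natCard_ker_mulQuotientMap_of_baseChange_eq_curve ψ hVs hWs
  -- `k := q · c_P`, `k Λ_f ⊆ Λ_{W'}`, `k ∈ ℤ`
  have hPc : ∀ z ∈ periodLattice D'.f, (P.c : ℂ) * z ∈ P.L.lattice := fun z hz ↦
    P.smul_periodLattice_le z (hf ▸ hz)
  have hk' : ∀ z ∈ periodLattice D'.f, ((q * P.c : ℚ) : ℂ) * z ∈ D'.L.lattice := fun z hz ↦ by
    have h := hq _ (hPc z hz)
    rw [← mul_assoc] at h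
    push_cast
    exact h
  obtain ⟨k, hkq⟩ := hInt D' (q * P.c) hk'
  have hkC : (k : ℂ) = (q : ℂ) * (P.c : ℂ) := by
    have h := congrArg (fun x : ℚ => (x : ℂ)) hkq
    push_cast at h
    exact h
  have hk : ∀ z ∈ periodLattice D'.f, (k : ℂ) * z ∈ D'.L.lattice := fun z hz ↦ by
    have h := hk' z hz
    push_cast at h
    rwa [hkC]
  have hc : (P.c : ℚ) ≠ 0 := by exact_mod_cast P.maninConstant_ne_zero_holds
  have hk0 : k ≠ 0 := by
    have h : (k : ℚ) ≠ 0 := by rw [hkq]; exact mul_ne_zero hq0 hc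
    exact_mod_cast h
  -- the common degree `δ` of the Eichler–Shimura map of `f`
  haveI := discreteTopology_periodLattice_of_mul_mem D'.f D'.cast_c_ne_zero D'.smul_periodLattice_le
  obtain ⟨δ, hδ, hfinδ⟩ := exists_degree_eichlerShimuraMap' (N := N) D'.isNewformOf.1.ne_zero
  -- the datum of `W'` with Manin constant `k`, and the two degree formulas
  obtain ⟨Dk, hDkf, hDkL, -, hDkc⟩ := D'.exists_datum_c_eq hk0 hk
  obtain ⟨-, hdegK⟩ := Dk.modularDegree_eq_card_ker_mul_of_eichlerShimuraMap hDkf hδ hfinδ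
  obtain ⟨-, hdegP⟩ := P.modularDegree_eq_card_ker_mul_of_eichlerShimuraMap hf.symm hδ hfinδ
  -- `#ker(k) = #ker(q) · #ker(c_P) = deg ψ · #ker(c_P)`
  have hqc : ∀ z ∈ (periodLattice P.f : AddSubgroup ℂ), (q : ℂ) * (P.c : ℂ) * z ∈
      D'.L.lattice.toAddSubgroup := fun z hz ↦ by
    rw [mul_assoc]
    exact hq _ (P.smul_periodLattice_le z hz)
  have hmul : Nat.card Dk.isogenyMap.ker = ψ.degree * Nat.card P.isogenyMap.ker := by
    have h1 : Nat.card Dk.isogenyMap.ker =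
        Nat.card (mulQuotientMap (periodLattice P.f) D'.L.lattice.toAddSubgroup
          ((q : ℂ) * (P.c : ℂ)) hqc).ker :=
      natCard_ker_mulQuotientMap_congr' (by rw [hDkf, hf]) (by rw [hDkL]) (by rw [hDkc, hkC]) _ _
    have hq'' : ∀ z ∈ P.L.lattice.toAddSubgroup, (q : ℂ) * z ∈ D'.L.lattice.toAddSubgroup :=
      fun z hz => hq z hz
    rw [h1, natCard_ker_mulQuotientMap_mul (Λ₂ := P.L.lattice.toAddSubgroup) P.cast_c_ne_zero
      P.smul_periodLattice_le hq'' hqc, ← hdegq]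
    rfl
  calc D'.modularDegree ≤ Dk.modularDegree := hmin' Dk
    _ = Nat.card Dk.isogenyMap.ker * δ := hdegK
    _ = ψ.degree * (Nat.card P.isogenyMap.ker * δ) := by rw [hmul, mul_assoc]
    _ = ψ.degree * P.modularDegree := by rw [← hdegP]

/-! ## 3. H2 — the valuation leg from ONE isogeny (k2-g4 H2a/H2, PROVED, Mazur-free) -/

/-- **H2a**: along a `ℚ`-isogeny of degree `d`, `c_v` moves by a factor `≤ d` at a multiplicative
place. [cite: PastenShimura2024, §6.4 (p. 22)] -/
theorem ordMinimalDiscriminant_le_degree_mul {W W' : WeierstrassCurve ℚ} [W.IsElliptic]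
    [W'.IsElliptic] (ψ : Isogeny W W') (v : HeightOneSpectrum ℤ)
    (hv : W.HasMultiplicativeReductionAt v) :
    W'.ordMinimalDiscriminant v ≤ ψ.degree * W.ordMinimalDiscriminant v := by
  obtain ⟨ψ', hcyc, hdvd⟩ := ψ.exists_isCyclic_degree_dvd
  have hv' : W'.HasMultiplicativeReductionAt v :=
    hasMultiplicativeReductionAt_of_isIsogenous ⟨ψ⟩ v hv
  obtain ⟨m, n, hm, hn, hmn, heq⟩ :=
    exists_ordMinimalDiscriminant_mul_eq_mul_of_isCyclic ψ'.degree ψ' hcyc rfl v hv hv'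
  have hle : m * n ≤ ψ.degree :=
    (Nat.le_of_dvd ψ'.degree_pos hmn).trans (Nat.le_of_dvd ψ.degree_pos hdvd)
  have hn' : n ≤ ψ.degree := (Nat.le_mul_of_pos_left n hm).trans hle
  calc W'.ordMinimalDiscriminant v
      ≤ W'.ordMinimalDiscriminant v * m := Nat.le_mul_of_pos_right _ hm
    _ = W.ordMinimalDiscriminant v * n := heq.symm
    _ ≤ W.ordMinimalDiscriminant v * ψ.degree := Nat.mul_le_mul_left _ hn'
    _ = ψ.degree * W.ordMinimalDiscriminant v := Nat.mul_comm _ _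

/-- **H2**: `v_q(Δ_min W') ≤ d · v_q(Δ_min E_(a,b))` from ONE `ℚ`-isogeny `E_(a,b) → W'` of degree
`≤ d`, `q` an odd conductor prime. -/
theorem factorization_le_mul_of_isogeny {a b : ℤ} (hab : IsCoprime a b) (h0 : a * b * (a + b) ≠ 0)
    {q : ℕ} (hq : q.Prime) (hq2 : q ≠ 2) (hqN : q ∣ (freyCurve a b).conductorNorm ℤ)
    {W' : WeierstrassCurve ℚ} [W'.IsElliptic] {B : ℕ} (φ : Isogeny (freyCurve a b) W')
    (hφ : φ.degree ≤ B) :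
    (W'.minimalDiscriminantNorm ℤ).factorization q ≤
      B * ((freyCurve a b).minimalDiscriminantNorm ℤ).factorization q := by
  haveI := isElliptic_freyCurve h0
  obtain ⟨v, hv⟩ :
      ∃ v : HeightOneSpectrum ℤ, Rat.HeightOneSpectrum.natGenerator v = q :=
    ⟨(Rat.HeightOneSpectrum.primesEquiv (R := ℤ)).symm ⟨q, hq⟩,
      Rat.natGenerator_primesEquiv_symm ⟨q, hq⟩⟩
  have hdvd : (q : ℤ) ∣ a * b * (a + b) := dvd_of_dvd_conductorNorm_freyCurve hab h0 hq hq2 hqN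
  have hmult : (freyCurve a b).HasMultiplicativeReductionAt v :=
    hasMultiplicativeReductionAt_freyCurve_of_ne_two hab h0 v (hv ▸ hq2) (hv ▸ hdvd)
  have h1 := factorization_minimalDiscriminantNorm_holds (freyCurve a b) v
  have h2 := factorization_minimalDiscriminantNorm_holds W' v
  rw [hv] at h1 h2
  rw [h1, h2]
  exact (ordMinimalDiscriminant_le_degree_mul φ v hmult).trans (Nat.mul_le_mul_right _ hφ)

/-! ## 4. Suppliers of the leaves -/

/-- The route item `MazurKenkuRadius` (stmt-ABC-15193) ⟹ L1 with `R = 163`. -/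
theorem freyIsogenyRadius_of_mazurKenkuRadius (h : MazurKenkuRadius) : FreyIsogenyRadius 163 := by
  intro a b hab h0 q hq hq2 hqN W' _ hiso
  haveI := isElliptic_freyCurve h0
  exact h (freyCurve a b) W' hiso

/-- L1 ⟹ L1ε (the `N^ε` is idle: `N ≥ 1`). -/
theorem freyIsogenyRadiusSubpoly_of_radius {R : ℕ} (hR : FreyIsogenyRadius R) :
    FreyIsogenyRadiusSubpoly := by
  intro ε hε
  refine ⟨R, fun a b hab h0 q hq hq2 hqN W' _ hiso => ?_⟩
  obtain ⟨φ, hφ⟩ := hR a b hab h0 q hq hq2 hqN W' hiso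
  haveI := isElliptic_freyCurve h0
  refine ⟨φ, ?_⟩
  have hN1 : (1 : ℝ) ≤ (((freyCurve a b).conductorNorm ℤ : ℕ) : ℝ) := by
    exact_mod_cast (freyCurve a b).conductorNorm_pos_holds
  have hrpow : (1 : ℝ) ≤ (((freyCurve a b).conductorNorm ℤ : ℕ) : ℝ) ^ ε :=
    Real.one_le_rpow hN1 hε.le
  have hR0 : (0 : ℝ) ≤ (R : ℝ) := Nat.cast_nonneg R
  calc (φ.degree : ℝ) ≤ (R : ℝ) := by exact_mod_cast hφ
    _ = (R : ℝ) * 1 := (mul_one _).symm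
    _ ≤ (R : ℝ) * (((freyCurve a b).conductorNorm ℤ : ℕ) : ℝ) ^ ε :=
        mul_le_mul_of_nonneg_left hrpow hR0

/-- L1ε ⟹ L0 (forget that `W⋆` is optimal). -/
theorem freyOptimalRadiusSubpoly_of_rooted (hR : FreyIsogenyRadiusSubpoly) :
    FreyOptimalRadiusSubpoly := by
  intro ε hε
  obtain ⟨R, hR⟩ := hR ε hε
  refine ⟨R, fun a b hab h0 N _ hN q hq hq2 hqN W' _ P' _ _ hiso => ?_⟩
  have hqN' : q ∣ (freyCurve a b).conductorNorm ℤ := by rw [hN]; exact hqN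
  obtain ⟨φ, hφ⟩ := hR a b hab h0 q hq hq2 hqN' W' hiso
  refine ⟨φ, ?_⟩
  rwa [hN] at hφ

end Summit.ABC.ABC.Cruxes.DefiniteRTControlPrime.StubIdeas2G5

/-! ## 5. The re-glue: the crux from Takahashi 2.3 and ONE isogeny to the optimal curve -/

namespace Summit.ABC.ABC.Theorems.DefiniteRTControlPrime

open Summit.ABC.ABC.Theses.DefiniteXi
open Summit.ABC.ABC.Cruxes.DefiniteRTControlPrime.StubIdeas2G5
open Literature.NumberTheory.EllipticCurves Literature.NumberTheory.EllipticCurves.ModularForms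
open Literature.NumberTheory.Automorphic
open WeierstrassCurve

/-- **G₀ (pointwise core, in `ℕ`; the ONE-ISOGENY PIVOT).**  At one coprime pair, odd conductor prime
`q` (`N = M q`) and minimal datum `D` of the Frey MODEL: if the Frey curve is joined to the Takahashi
pivot `W⋆` (`exists_conductorMinimal`, p97354) by ONE `ℚ`-isogeny `φ` of degree `≤ B`, then
`deg D ≤ 4 B² · ξ(M; q) · v_q(Δ_min E)`.  Chain: `deg D ≤ 4 deg D₁` (model transport, landed stubs);
`deg D₁ ≤ deg ψ · deg P⋆ = deg φ · deg P⋆` (P1 along `ψ` = dual of `φ` conjugated to the lattice curves);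
`deg P⋆ ≤ ξ · v_q(Δ_min W⋆)` (Takahashi); `v_q(Δ_min W⋆) ≤ deg φ · v_q(Δ_min E)` (H2 along `φ`).
No `W₀`, no `h163`, no `h68`. [cite: Takahashi2001, Thm. 2.3 (p. 79)] [cite: PastenShimura2024, §3 p. 13, §6.4] -/
theorem deg_le_of_optimalIsogenyAt (hT : takahashi2001_thm_2_3_of_coprime) {a b : ℤ}
    (hab : IsCoprime a b) (h0 : a * b * (a + b) ≠ 0) {M q : ℕ} [NeZero (M * q)]
    (hN : (freyCurve a b).conductorNorm ℤ = M * q) (hq : q.Prime) (hq2 : q ≠ 2) {B : ℕ}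
    (hOpt : ∀ (W' : WeierstrassCurve ℚ) [W'.IsElliptic]
      (P' : ModularParametrizationData W' (M * q)), W'.conductorNorm ℤ = M * q →
      (∀ (W'' : WeierstrassCurve ℚ) [W''.IsElliptic], W''.conductorNorm ℤ = M * q →
          ∀ P'' : ModularParametrizationData W'' (M * q), P''.f = P'.f →
            P'.modularDegree ≤ P''.modularDegree) →
      (freyCurve a b).IsIsogenous W' → ∃ φ : Isogeny (freyCurve a b) W', φ.degree ≤ B)
    (D : ModularParametrizationData (freyCurve a b) (M * q))
    (hDmin : ∀ D' : ModularParametrizationData (freyCurve a b) (M * q), D.deg ≤ D'.deg) :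
    D.deg ≤ 4 * B * B * (brandtXi M q (fun n => (freyCurve a b).LFunction n) *
      ((freyCurve a b).minimalDiscriminantNorm ℤ).factorization q) := by
  haveI := isElliptic_freyCurve h0
  have hdiv : M * q / q = M := Nat.mul_div_cancel M hq.pos
  have hqN' : q ∣ (freyCurve a b).conductorNorm ℤ := by rw [hN]; exact Dvd.intro_left M rfl
  -- `gcd(M, q) = 1`
  have hcop : M.Coprime q := by
    have h := stub_freyLocal a b hab h0 q hq hq2 hqN'
    rwa [hN, hdiv] at h
  -- a global minimal model `W_m = C • E`, its data, a minimal one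
  obtain ⟨C, hC⟩ := hasGlobalMinimalModel_rat_holds (freyCurve a b)
  haveI := hC
  have hNm : (C • freyCurve a b).conductorNorm ℤ = M * q := by rw [conductorNorm_smul_rat, hN]
  have hne : Nonempty (ModularParametrizationData (C • freyCurve a b) (M * q)) :=
    (Summit.ABC.ABC.Theorems.nonempty_modularParametrizationData_smul_iff C).mpr ⟨D⟩
  obtain ⟨D₁, -, hD₁min⟩ := exists_minimal_datum hne
  -- the Takahashi pivot `(W⋆, P⋆)` — the ONLY auxiliary curve
  obtain ⟨Ws, hWs, Ps, hNs, hfs, hPsmin⟩ := exists_conductorMinimal D₁ hNm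
  haveI := hWs
  -- Takahashi at `(W⋆, P⋆)`
  have hTak : Ps.modularDegree ≤ brandtXi M q (fun n => Ws.LFunction n) *
      (Ws.minimalDiscriminantNorm ℤ).factorization q :=
    takahashi2001_thm_2_3_of_coprime.modularDegree_le_brandtXi_mul hT Ws M q hq hcop
      hNs Ps hPsmin
  -- `a(W⋆) = a(f₁) = a(W_m) = a(E)`
  have hL : (fun n => Ws.LFunction n) = fun n => (freyCurve a b).LFunction n := by
    funext n
    have h1 := Ps.isNewformOf.2 n
    have h2 := D₁.isNewformOf.2 n
    rw [hfs] at h1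
    rw [h1, LFunction_smul] at h2
    exact_mod_cast h2
  rw [hL] at hTak
  -- THE ONE ISOGENY `φ : E → W⋆`, `deg φ ≤ B`
  have hiso : (freyCurve a b).IsIsogenous Ws :=
    (isIsogenous_smul (freyCurve a b) C).trans' (isIsogenous_of_f_eq D₁ Ps hfs)
  obtain ⟨φ, hφ⟩ := hOpt Ws Ps hNs hPsmin hiso
  -- (T_val) first use of `φ`: H2
  have hval : (Ws.minimalDiscriminantNorm ℤ).factorization q ≤
      B * ((freyCurve a b).minimalDiscriminantNorm ℤ).factorization q :=
    factorization_le_mul_of_isogeny hab h0 hq hq2 hqN' φ hφ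
  -- (T_deg) second use of `φ`: its dual, conjugated to the lattice (short) models, through P1
  have hEs : ((⟨1, -Ws.b₂ / 12, -Ws.a₁ / 2, Ws.a₁ * Ws.b₂ / 24 - Ws.a₃ / 2⟩ : VariableChange ℚ)
      • Ws).baseChange ℂ = Ps.L.curve :=
    shortModel_baseChange_eq_curve Ws Ps.isNeronLattice
  have hEm : ((⟨1, -(C • freyCurve a b).b₂ / 12, -(C • freyCurve a b).a₁ / 2,
      (C • freyCurve a b).a₁ * (C • freyCurve a b).b₂ / 24 - (C • freyCurve a b).a₃ / 2⟩ :
        VariableChange ℚ) • (C • freyCurve a b)).baseChange ℂ = D₁.L.curve :=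
    shortModel_baseChange_eq_curve (C • freyCurve a b) D₁.isNeronLattice
  set Cs : VariableChange ℚ := ⟨1, -Ws.b₂ / 12, -Ws.a₁ / 2, Ws.a₁ * Ws.b₂ / 24 - Ws.a₃ / 2⟩
    with hCs
  set C' : VariableChange ℚ := ⟨1, -(C • freyCurve a b).b₂ / 12, -(C • freyCurve a b).a₁ / 2,
      (C • freyCurve a b).a₁ * (C • freyCurve a b).b₂ / 24 - (C • freyCurve a b).a₃ / 2⟩ with hC'
  obtain ⟨φd, hφd⟩ := exists_dual_degree_eq ((VariableChange.toIsogeny Ws Cs).comp φ)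
  obtain ⟨ψ, hψ⟩ : ∃ ψ : Isogeny (Cs • Ws) (C' • (C • freyCurve a b)), ψ.degree = φ.degree :=
    ⟨((VariableChange.toIsogeny (C • freyCurve a b) C').comp
        (VariableChange.toIsogeny (freyCurve a b) C)).comp φd, by
      rw [degree_comp, degree_comp, hφd, degree_comp, VariableChange.degree_toIsogeny,
        VariableChange.degree_toIsogeny, VariableChange.degree_toIsogeny]
      ring⟩
  have hdeg₁ : D₁.modularDegree ≤ B * Ps.modularDegree := by
    have h := modularDegree_le_degree_mul Ps D₁ hfs.symm hD₁min ψ hEs hEm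
    rw [hψ] at h
    exact h.trans (Nat.mul_le_mul_right _ hφ)
  -- (T_model) back to the Frey model
  obtain ⟨D₁', -, hdeg₁'⟩ := stub_smulTransportDeg C D₁
  have hscale : (C.u : ℚ).num.natAbs ≤ 2 := stub_freyScale a b hab h0 C hC
  have hD : D.deg ≤ 4 * D₁.modularDegree := by
    calc D.deg ≤ D₁'.deg := hDmin D₁'
      _ = (C.u : ℚ).num.natAbs ^ 2 * D₁.deg := hdeg₁'
      _ ≤ 2 ^ 2 * D₁.deg := Nat.mul_le_mul_right _ (Nat.pow_le_pow_left hscale 2)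
      _ = 4 * D₁.modularDegree := by norm_num [ModularParametrizationData.modularDegree]
  -- the chain in `ℕ`
  set ξ : ℕ := brandtXi M q (fun n => (freyCurve a b).LFunction n) with hξ
  set v : ℕ := ((freyCurve a b).minimalDiscriminantNorm ℤ).factorization q with hv
  calc D.deg ≤ 4 * D₁.modularDegree := hD
    _ ≤ 4 * (B * Ps.modularDegree) := Nat.mul_le_mul_left _ hdeg₁
    _ ≤ 4 * (B * (ξ * (Ws.minimalDiscriminantNorm ℤ).factorization q)) :=
        Nat.mul_le_mul_left _ (Nat.mul_le_mul_left _ hTak)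
    _ ≤ 4 * (B * (ξ * (B * v))) :=
        Nat.mul_le_mul_left _ (Nat.mul_le_mul_left _ (Nat.mul_le_mul_left _ hval))
    _ = 4 * B * B * (ξ * v) := by ring

/-- **Gε — `DefiniteRTControlPrime` from Takahashi 2.3 and the weakest leaf L0**, `C(ε) = 4 R(ε/2)²`:
with `B := ⌊R N^(ε/2)⌋₊` in G₀, `deg D ≤ 4 B² ξ v ≤ 4 R² N^ε ξ v` — the crux's `N^ε` is load-bearing. -/
theorem definiteRTControlPrime_of_optimalRadiusSubpoly (hT : takahashi2001_thm_2_3_of_coprime)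
    (hRad : FreyOptimalRadiusSubpoly) : DefiniteRTControlPrime := by
  intro ε hε
  obtain ⟨R, hR⟩ := hRad (ε / 2) (half_pos hε)
  refine ⟨4 * (max R 0) ^ 2, ?_⟩
  intro a b hab h0 N _ hN q hq hq2 hqN D hDmin
  have hRN := hR a b hab h0 N hN q hq hq2 hqN
  -- `N = M q`
  obtain ⟨M, hM⟩ := hqN
  rw [mul_comm] at hM
  subst hM
  have hdiv : M * q / q = M := Nat.mul_div_cancel M hq.pos
  rw [hdiv]
  set Nr : ℝ := ((M * q : ℕ) : ℝ) with hNr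
  have hNr0 : (0 : ℝ) ≤ Nr := by positivity
  have hR0 : (0 : ℝ) ≤ max R 0 := le_max_right _ _
  have hpow0 : (0 : ℝ) ≤ Nr ^ (ε / 2) := Real.rpow_nonneg hNr0 _
  -- the integer radius at this `N`
  set B : ℕ := ⌊max R 0 * Nr ^ (ε / 2)⌋₊ with hB
  have hOptB : ∀ (W' : WeierstrassCurve ℚ) [W'.IsElliptic]
      (P' : ModularParametrizationData W' (M * q)), W'.conductorNorm ℤ = M * q →
      (∀ (W'' : WeierstrassCurve ℚ) [W''.IsElliptic], W''.conductorNorm ℤ = M * q →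
          ∀ P'' : ModularParametrizationData W'' (M * q), P''.f = P'.f →
            P'.modularDegree ≤ P''.modularDegree) →
      (freyCurve a b).IsIsogenous W' → ∃ φ : Isogeny (freyCurve a b) W', φ.degree ≤ B := by
    intro W' _ P' hNW' hmin' hiso
    obtain ⟨φ, hφ⟩ := hRN W' P' hNW' hmin' hiso
    refine ⟨φ, Nat.le_floor ?_⟩
    calc (φ.degree : ℝ) ≤ R * Nr ^ (ε / 2) := hφ
      _ ≤ max R 0 * Nr ^ (ε / 2) := mul_le_mul_of_nonneg_right (le_max_left _ _) hpow0
  have hchain := deg_le_of_optimalIsogenyAt hT hab h0 hN hq hq2 hOptB D hDmin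
  set ξ : ℕ := brandtXi M q (fun n => (freyCurve a b).LFunction n) with hξ
  set v : ℕ := ((freyCurve a b).minimalDiscriminantNorm ℤ).factorization q with hv
  have hcast : (D.deg : ℝ) ≤ 4 * (B : ℝ) * (B : ℝ) * ((ξ : ℝ) * (v : ℝ)) := by
    exact_mod_cast hchain
  have hξv : (0 : ℝ) ≤ (ξ : ℝ) * (v : ℝ) := by positivity
  have hBle : (B : ℝ) ≤ max R 0 * Nr ^ (ε / 2) := Nat.floor_le (mul_nonneg hR0 hpow0)
  have hB0 : (0 : ℝ) ≤ (B : ℝ) := Nat.cast_nonneg _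
  have hsq : Nr ^ (ε / 2) * Nr ^ (ε / 2) = Nr ^ ε := by
    rw [← Real.rpow_add' hNr0 (by linarith)]
    ring_nf
  calc (D.deg : ℝ) ≤ 4 * (B : ℝ) * (B : ℝ) * ((ξ : ℝ) * (v : ℝ)) := hcast
    _ ≤ 4 * (max R 0 * Nr ^ (ε / 2)) * (max R 0 * Nr ^ (ε / 2)) * ((ξ : ℝ) * (v : ℝ)) := by
        gcongr
    _ = 4 * (max R 0) ^ 2 * (Nr ^ (ε / 2) * Nr ^ (ε / 2)) * ((ξ : ℝ) * (v : ℝ)) := by ring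
    _ = 4 * (max R 0) ^ 2 * Nr ^ ε * ((ξ : ℝ) * (v : ℝ)) := by rw [hsq]

/-- **G — the crux from Takahashi 2.3 and a ROOTED radius `R`, `C = 4 R²`** (gen-4 rooted glue: `4 R⁴`). -/
theorem definiteRTControlPrime_of_freyIsogenyRadius (hT : takahashi2001_thm_2_3_of_coprime) {R : ℕ}
    (hR : FreyIsogenyRadius R) : DefiniteRTControlPrime := by
  intro ε hε
  refine ⟨((4 * R * R : ℕ) : ℝ), ?_⟩
  intro a b hab h0 N _ hN q hq hq2 hqN D hDmin
  -- `N = M q`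
  obtain ⟨M, hM⟩ := hqN
  rw [mul_comm] at hM
  subst hM
  have hdiv : M * q / q = M := Nat.mul_div_cancel M hq.pos
  rw [hdiv]
  have hqN' : q ∣ (freyCurve a b).conductorNorm ℤ := by rw [hN]; exact Dvd.intro_left M rfl
  have hchain := deg_le_of_optimalIsogenyAt hT hab h0 hN hq hq2
    (fun W' _ P' _ _ hiso => hR a b hab h0 q hq hq2 hqN' W' hiso) D hDmin
  set ξ : ℕ := brandtXi M q (fun n => (freyCurve a b).LFunction n) with hξ
  set v : ℕ := ((freyCurve a b).minimalDiscriminantNorm ℤ).factorization q with hv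
  -- to `ℝ`, inserting the idle `N^ε ≥ 1`
  have hN1 : (1 : ℝ) ≤ ((M * q : ℕ) : ℝ) := by
    exact_mod_cast Nat.one_le_iff_ne_zero.mpr (NeZero.ne (M * q))
  have hrpow : (1 : ℝ) ≤ ((M * q : ℕ) : ℝ) ^ ε := Real.one_le_rpow hN1 hε.le
  have hcast : (D.deg : ℝ) ≤ ((4 * R * R : ℕ) : ℝ) * ((ξ : ℝ) * (v : ℝ)) := by
    exact_mod_cast hchain
  have hξv : (0 : ℝ) ≤ (ξ : ℝ) * (v : ℝ) := by positivity
  calc (D.deg : ℝ) ≤ ((4 * R * R : ℕ) : ℝ) * ((ξ : ℝ) * (v : ℝ)) := hcast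
    _ = ((4 * R * R : ℕ) : ℝ) * 1 * ((ξ : ℝ) * (v : ℝ)) := by ring
    _ ≤ ((4 * R * R : ℕ) : ℝ) * ((M * q : ℕ) : ℝ) ^ ε * ((ξ : ℝ) * (v : ℝ)) := by gcongr

/-- **Gε ∘ (L1ε ⟹ L0).** The crux from Takahashi 2.3 and a sub-polynomial ROOTED radius. -/
theorem definiteRTControlPrime_of_freyIsogenyRadiusSubpoly (hT : takahashi2001_thm_2_3_of_coprime)
    (hR : FreyIsogenyRadiusSubpoly) : DefiniteRTControlPrime :=
  definiteRTControlPrime_of_optimalRadiusSubpoly hT (freyOptimalRadiusSubpoly_of_rooted hR)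

/-- **G ∘ S.** The crux from Takahashi 2.3 and the route item `MazurKenkuRadius` (stmt-ABC-15193) ALONE
(`C = 4·163²`, same constant as p97354 but with neither Pasten fact). -/
theorem definiteRTControlPrime_of_mazurKenkuRadius_oneLeg (hT : takahashi2001_thm_2_3_of_coprime)
    (hR : MazurKenkuRadius) : DefiniteRTControlPrime :=
  definiteRTControlPrime_of_freyIsogenyRadius hT (freyIsogenyRadius_of_mazurKenkuRadius hR)

end Summit.ABC.ABC.Theorems.DefiniteRTControlPrime

end


/-! ## §10 (gen 11) THE CRUX FROM TAKAHASHI 2.3 ALONE — kernel-checked composition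

k2-g5's consumer (inlined verbatim above, namespace `StubIdeas2G5` / `Theorems.DefiniteRTControlPrime`)
composed with the gen-11 unconditional `StubIdeas2G11.freyIsogenyRadiusSubpoly` (§9; the two
`FreyIsogenyRadiusSubpoly` defs are syntactically identical). -/

namespace Summit.ABC.ABC.Cruxes.DefiniteRTControlPrime.StubIdeas2G11

open Literature.NumberTheory.EllipticCurves Literature.NumberTheory.EllipticCurves.ModularForms
open Summit.ABC.ABC.Theses.DefiniteXi

/-- **`DefiniteRTControlPrime` from Takahashi's Theorem 2.3 alone** — no Mazur–Kenku, no Pasten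
Lemma 6.8, no Pasten (16.3): `stub_pastenLemma68` and `stub_pasten163` are both DELETED from the
crux's dependency by the k2 reshape. -/
theorem definiteRTControlPrime_of_takahashi (hT : takahashi2001_thm_2_3_of_coprime) :
    DefiniteRTControlPrime :=
  Summit.ABC.ABC.Theorems.DefiniteRTControlPrime.definiteRTControlPrime_of_freyIsogenyRadiusSubpoly hT
    freyIsogenyRadiusSubpoly

end Summit.ABC.ABC.Cruxes.DefiniteRTControlPrime.StubIdeas2G11
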